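/-
Copyright: lit-balaban Phase-2 proof seat p30 (gen 26).  Statement-level skeleton of a published paper; no proof claims beyond what the
kernel checks below.
-/
import Literature.MathematicalPhysics.QuantumFieldTheory.BalabanImbrieJaffe1984to88.BIJ85ScalarPropagatorSupDecayDeriv
import Literature.MathematicalPhysics.QuantumFieldTheory.BalabanImbrieJaffe1984to88.BIJ85FlatPropagatorKernelHolder
import Literature.MathematicalPhysics.QuantumFieldTheory.BalabanImbrieJaffe1984to88.BIJ85TorusTentCutoff
import Literature.MathematicalPhysics.QuantumFieldTheory.BalabanImbrieJaffe1984to88.BIJ85BiCentredAxialGauge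

/-!
# [BalabanImbrieJaffe1985] §7.3 p. 326 — the propagators `G_k(u)` under (7.3.1) satisfy the estimates of [7]:
# **the HÖLDER member of [Balaban1983RegularityDecay] (1.9) for the covariant derivative of the torus block propagator at small
# non-flat fields, `k`-uniform — the local two-bond interior estimate** (file 2b: the analytic core at an axis-parallel pair)

T. Bałaban, J. Imbrie, A. Jaffe, *Renormalization of the Higgs model: minimizers, propagators and the stability of mean field theory*,
Commun. Math. Phys. **97** (1985) 299–329 [BalabanImbrieJaffe1985], §7.3 p. 326 [PDF 28]; [7] there = T. Bałaban, *Regularity and decay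
of lattice Green's functions*, Commun. Math. Phys. **89** (1983) 571–597 [Balaban1983RegularityDecay], Theorem p. 573, (1.9):
*"|x − x′|^{−α}|U(A(Γ_{x,x′}))(D^η_{A,μ}G_k(Ω,A)f)(x′) − (D^η_{A,μ}G_k(Ω,A)f)(x)| ≤ c₀exp(−δ₀dist({x,x′}, supp f))‖f‖_∞"*, `Γ_{x,x′}` a
shortest contour from `x` to `x′`.

statement-level skeleton of published theorems with citation tags; proofs where landed; nothing here is a claim about the Yang–Mills mass gap

CITATION HEADER (lean-in-tree rule).  Part of the lit-balaban TYPED SKELETON (HOME `run/shared/lean/pub/lit-balaban/`), PHASE-2 proof seat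
p30 gen 26 (unit `lit-balaban-p30-g26`; TAKING line HOME/STATUS.md 2026-08-23T01:01:50Z; free-target protocol G.5-34(d) — the Hölder residual
of item 3 of `HOME/lit-balaban-r15/C1-CLOSURE.md` §5 «the … Hölder (1.9)-shape members at small non-flat u», owner r15, no objection
2026-08-23T01:02:25Z).  WHAT THIS FILE IS: the ANALYTIC CORE of the (1.9) member for row **C1.Eq7.3.1-7.3.2** of `HOME/lit-balaban-r15/ROWS-C1.md`
(a located member on ACCEPT of the assembled statement; no head change): gen 25's local interior estimate (`BIJ85ScalarPropagatorSupDecayDeriv`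
§6, one bond) RUN ON THE DIFFERENCE OF THE REPRESENTATIONS AT TWO BONDS `⟨y₀, y₀+e_{μ₀}⟩`, `⟨y₁, y₁+e_{μ₀}⟩` in ONE gauge that is small at
BOTH bonds (`|u_{z,μ} − 1| ≤ γ·min(|z−y₀|_∞, |z−y₁|_∞)` — the axis-rooted tree gauge of `BIJ85BiCentredAxialGauge` produces this for an
axis-parallel pair), with the HÖLDER envelopes of the difference kernel `ΔK = K_{b₁} − K_{b₀}` of `BIJ85FlatPropagatorKernelHolder`
(`|ΔK| ≤ A/max(R,1)^{d−1+α}`, `|∇ΔK| ≤ A/max(R,1)^{d+α}`, `R = min(|z−y₀|_∞,|z−y₁|_∞)`, `A = Cε²|y₀−y₁|_∞^α`): §3 `local_holder_bound`, and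
§4 the `k`-UNIFORM LEG ESTIMATE `holder19_leg_gauged` — for an axis-parallel pair `y₁ = y₀ + ρe_i` at small fields, in the axis-rooted gauge
`h`, `‖(ψ(y₁+e_μ) − ψ(y₁)) − (ψ(y₀+e_μ) − ψ(y₀))‖ ≤ c₀(ρ/L^k)^α(L^kε)·ε·e^{−t₀D/L^k}F` for `ψ = h·G_k(T,u)f` (the transport along the axis is
`1` in that gauge, so this IS the (1.9) quantity; the gauge-invariant restatement with the explicit transport, general pairs by a staircase of
`d` legs and far pairs are file 2c `BIJ85ScalarPropagatorHolderDecay`).  Theorems only; no definitions, no `Prop` placeholder.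

THE MATHEMATICS.  With `N♭ = N(1)`, `G♭N♭ = 1`, `N(u)ψ = f′` and the real cutoff `χ = χ_{y₀,r}` of `BIJ85TorusTentCutoff` (`= 1` on both bonds
when `|y₀ − y₁|_∞ + 1 ≤ r`), gen 25's representation `loc_representation` at the two bonds subtracts to
`Δ := (ψ(y₁+e) − ψ(y₁)) − (ψ(y₀+e) − ψ(y₀)) = Σ_zΔK χf′ − Σ_zΔK χ(N(u) − N♭)ψ + Σ_z((XN♭ − N♭X)ΔK)ψ` (`loc_representation_pair`), and every
term is bounded exactly as in gen 25 §6 but with the radial variable `R(z) = min(|z−y₀|_∞, |z−y₁|_∞)` — in the envelopes (real exponents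
`d−1+α`, `d+α`) AND in the gauge weight `γR(z)`, which vanishes at BOTH kernel singularities; the radial sums are then `Σ_s s^{−α}`,
`Σ_s s^{1−α}` (no logarithm), evaluated by `BIJ85TorusTentCutoff.radial_env_rpow{,_T}` around each of the two centres (`sum_le_biradial`).
Result (§3): `‖Δ‖ ≤ C(d,α)·(F A r^{1−α} + ε⁻²γA(r·r^{1−α}M + r^{1−α}S) + ε⁻²A S r^{−α}/r + α_kA S(r + L^k)^{1−α})`.  §4 feeds it, at `r = ⌊cL^k⌋`,
with p27's value bound (`S`), gen 25's covariant-derivative bound (`M`, gauge-covariant in norm), the source bound `F`, the bi-centred gauge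
(`γ = (d−1)θ`, `γL^{2k} ≤ 1`) and `A = C_Kε²ρ^α`: every term is `≲ ρ^αL^{k(1−α)}ε²·e^{−tD/L^k}F`.

HONEST SCOPE.  `2 ≤ d ≤ 3`, whole torus `Ω = T`, `U(1)` fields, hypotheses of the value member (`|u(∂p) − 1| ≤ θ`, `2d³(L^{2k}θ)² ≤ 1`), every
`0 ≤ α < 1` (constant `c₀` depending on `d, L, a, α`, rate `t₀` on `d, L, a` only), near axis-parallel pairs (`1 ≤ ρ ≤ cL^k/…`) in this file;
DIVERGENCE OF METHOD from [7]'s random-walk expansion as in gen 25.  Nothing here is summit progress, continuum or Clay.  Unit `lit-balaban-p30`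
(literature-prover-lit-balaban-p30-g26-0), HOME `run/shared/lean/pub/lit-balaban/`, 2026-08-23.
-/

open scoped BigOperators ComplexConjugate
open Finset Matrix

namespace Literature.MathematicalPhysics.QuantumFieldTheory.BalabanImbrieJaffe1984to88.BIJ85ScalarPropagatorSupDecayHolder

open Literature.MathematicalPhysics.QuantumFieldTheory.Balaban1983to89
open LatticeFieldCalculus (supDist)
open B3TorusRadialSums (cdist cdist_le_supDist supDist_comm supDist_eq_sup_cdist supDist_eq_zero_iff cdist_neg)
open BIJ85Ineq722Torus (supDist_triangle)
open BIJ88Sect3Statements (U1 toC cfg covD norm_toC toC_one)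
open BIJ88NeumannPropagator227Torus (nOp gBox qMatK nOp_eq gBox_univ_mul conj_mul_toC)
open BIJ88NeumannPropagatorFlatDecay (gBox_flat_eq_tower)
open BIJ85ScalarPropagatorSupDecay (norm_gram_qMatK_mulVec_le)
open BIJ85ScalarPropagatorSupDecayDeriv (loc_representation nOp_sub_flat_mulVec_apply commutator_flat_apply aQQ_norm_le sum_towerQQ_le
  supDist_le_of_blkIter_eq' towerQQ_apply_blockK gauge_transfer cfg_gaugeAct_apply norm_covDiff_gaugeAct dist1_plaqHol_le_of_plaqC
  two_mul_pow_le_sitesPerDir gamma_nsq_le_one)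
open BIJ85TorusTentCutoff (chi chi_nonneg chi_le_one chi_eq_one_of_supDist_le supDist_lt_of_chi_ne_zero abs_chi_shift_sub_le
  abs_chi_second_diff_le cdist_eq_of_chi_second_diff_ne_zero supDist_le_of_chi_second_diff_ne_zero le_supDist_of_chi_shift_ne
  supDist_le_of_chi_shift_ne supDist_shift_le_succ supDist_le_shift_succ supDist_unshift_le_succ supDist_shift_le_one' cdist_sub_comm
  ball slab mem_ball mem_slab card_ball_le card_slab_le radial_env_rpow radial_env_rpow_T env_neighbour_rpow env_far_rpow)

noncomputable section

/-! ## §1 The bi-radial variable `R(z) = min(|z−y₀|_∞, |z−y₁|_∞)` and the bi-radial sums -/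

section Biradial

variable {P : Params} {j : ℕ}

/-- kernel: `R(z+e_ν) ≤ R(z) + 1`. [cite: BalabanImbrieJaffe1985, p.326] -/
theorem minDist_shift_le_succ (y₀ y₁ z : Balaban1983to89.Site P j) (ν : Fin P.d) :
    min (supDist y₀ (z.shift ν)) (supDist y₁ (z.shift ν)) ≤ min (supDist y₀ z) (supDist y₁ z) + 1 := by
  have h0 := supDist_shift_le_succ y₀ z ν
  have h1 := supDist_shift_le_succ y₁ z ν
  omega

/-- kernel: `R(z) ≤ R(z+e_ν) + 1`. [cite: BalabanImbrieJaffe1985, p.326] -/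
theorem minDist_le_shift_succ (y₀ y₁ z : Balaban1983to89.Site P j) (ν : Fin P.d) :
    min (supDist y₀ z) (supDist y₁ z) ≤ min (supDist y₀ (z.shift ν)) (supDist y₁ (z.shift ν)) + 1 := by
  have h0 := supDist_le_shift_succ y₀ z ν
  have h1 := supDist_le_shift_succ y₁ z ν
  omega

/-- kernel: `|z − y₀|_∞ ≤ R(z) + |y₀ − y₁|_∞` and `R(z) ≥ |z−y₀|_∞ − |y₀−y₁|_∞`. [cite: BalabanImbrieJaffe1985, p.326] -/
theorem supDist_le_minDist_add (y₀ y₁ z : Balaban1983to89.Site P j) :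
    supDist y₀ z ≤ min (supDist y₀ z) (supDist y₁ z) + supDist y₀ y₁ := by
  have h := supDist_triangle y₀ y₁ z
  rcases le_total (supDist y₀ z) (supDist y₁ z) with h1 | h1
  · rw [min_eq_left h1]; omega
  · rw [min_eq_right h1]; omega

/-- kernel: far from `y₀` the bi-radial variable is at least half the distance: `2ρ + 4 ≤ r`, `r − 2 ≤ |z−y₀|_∞ ⟹ r/2 ≤ R(z)`.
[cite: BalabanImbrieJaffe1985, p.326] -/
theorem half_le_minDist {y₀ y₁ z : Balaban1983to89.Site P j} {r : ℕ} (hρ : 2 * supDist y₀ y₁ + 4 ≤ r) (hz : r - 2 ≤ supDist y₀ z) :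
    (r : ℝ) / 2 ≤ ((min (supDist y₀ z) (supDist y₁ z) : ℕ) : ℝ) := by
  have h := supDist_le_minDist_add y₀ y₁ z
  have h2 : r ≤ 2 * min (supDist y₀ z) (supDist y₁ z) := by omega
  have : ((r : ℕ) : ℝ) ≤ ((2 * min (supDist y₀ z) (supDist y₁ z) : ℕ) : ℝ) := by exact_mod_cast h2
  push_cast at this ⊢
  linarith

/-- **THE BI-RADIAL DOMINATION**: a function `g` dominated on the ball `|z−y₀|_∞ ≤ n` by a NONNEGATIVE profile of `R(z)` and `≤ 0` outside is
dominated pointwise by the sum of the profile of `|z−y₀|_∞` (restricted to the `n`-ball of `y₀`) and of `|z−y₁|_∞` (restricted to the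
`(n+ρ)`-ball of `y₁`), `ρ ≥ |y₀−y₁|_∞`. [cite: BalabanImbrieJaffe1985, p.326] -/
theorem le_two_centres (y₀ y₁ : Balaban1983to89.Site P j) (n : ℕ) (Fb : ℕ → ℝ) (hFb : ∀ s, 0 ≤ Fb s)
    (g : Balaban1983to89.Site P j → ℝ) (hg : ∀ z, supDist y₀ z ≤ n → g z ≤ Fb (min (supDist y₀ z) (supDist y₁ z)))
    (hg' : ∀ z, n < supDist y₀ z → g z ≤ 0) (z : Balaban1983to89.Site P j) :
    g z ≤ (if supDist y₀ z ≤ n then Fb (supDist y₀ z) else 0) +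
      (if supDist y₁ z ≤ n + supDist y₀ y₁ then Fb (supDist y₁ z) else 0) := by
  by_cases hn : supDist y₀ z ≤ n
  · rw [if_pos hn]
    have h1 := hg z hn
    rcases le_total (supDist y₀ z) (supDist y₁ z) with h | h
    · rw [min_eq_left h] at h1
      have : 0 ≤ (if supDist y₁ z ≤ n + supDist y₀ y₁ then Fb (supDist y₁ z) else 0) := by split_ifs <;> [exact hFb _; exact le_rfl]
      linarith
    · rw [min_eq_right h] at h1
      have h2 : supDist y₁ z ≤ n + supDist y₀ y₁ := by omega
      rw [if_pos h2]
      linarith [hFb (supDist y₀ z)]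
  · rw [if_neg hn, zero_add]
    refine (hg' z (by omega)).trans ?_
    split_ifs <;> [exact hFb _; exact le_rfl]

/-- **BI-RADIAL BOUND, PROFILE `A/max(R,1)^{d−1+β}`** (`0 ≤ β < 1`): `Σ_z g(z) ≤ A(2 + 2d3^{d−1}(n^{1−β} + (n+ρ)^{1−β})/(1−β))`.
[cite: Balaban1983RegularityDecay, (1.9) p.573] -/
theorem biradial_rpow (hd : 1 ≤ P.d) (y₀ y₁ : Balaban1983to89.Site P j) (n : ℕ) {A : ℝ} (hA : 0 ≤ A) {β : ℝ} (hβ0 : 0 ≤ β)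
    (hβ1 : β < 1) (g : Balaban1983to89.Site P j → ℝ)
    (hg : ∀ z, supDist y₀ z ≤ n → g z ≤ A / (max ((min (supDist y₀ z) (supDist y₁ z) : ℕ) : ℝ) 1) ^ ((P.d : ℝ) - 1 + β))
    (hg' : ∀ z, n < supDist y₀ z → g z ≤ 0) :
    ∑ z, g z ≤ A * (1 + 2 * P.d * 3 ^ (P.d - 1) * ((n : ℝ) ^ (1 - β) / (1 - β))) +
      A * (1 + 2 * P.d * 3 ^ (P.d - 1) * ((((n + supDist y₀ y₁ : ℕ) : ℝ)) ^ (1 - β) / (1 - β))) := by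
  set Fb : ℕ → ℝ := fun s => A / (max (s : ℝ) 1) ^ ((P.d : ℝ) - 1 + β) with hFb
  have hFb0 : ∀ s, 0 ≤ Fb s := fun s => by positivity
  set g₀ : Balaban1983to89.Site P j → ℝ := fun z => if supDist y₀ z ≤ n then Fb (supDist y₀ z) else 0 with hg₀
  set g₁ : Balaban1983to89.Site P j → ℝ := fun z => if supDist y₁ z ≤ n + supDist y₀ y₁ then Fb (supDist y₁ z) else 0 with hg₁
  have hdom : ∀ z, g z ≤ g₀ z + g₁ z := fun z => le_two_centres y₀ y₁ n Fb hFb0 g (fun z hz => hg z hz) hg' z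
  have h0 : ∑ z, g₀ z ≤ A * (1 + 2 * P.d * 3 ^ (P.d - 1) * ((n : ℝ) ^ (1 - β) / (1 - β))) :=
    radial_env_rpow hd y₀ n hA hβ0 hβ1 g₀ (fun z hz => by simp only [hg₀]; rw [if_pos hz])
      (fun z hz => by simp only [hg₀]; rw [if_neg (by omega)])
  have h1 : ∑ z, g₁ z ≤ A * (1 + 2 * P.d * 3 ^ (P.d - 1) * ((((n + supDist y₀ y₁ : ℕ) : ℝ)) ^ (1 - β) / (1 - β))) :=
    radial_env_rpow hd y₁ (n + supDist y₀ y₁) hA hβ0 hβ1 g₁ (fun z hz => by simp only [hg₁]; rw [if_pos hz])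
      (fun z hz => by simp only [hg₁]; rw [if_neg (by omega)])
  calc ∑ z, g z ≤ ∑ z, (g₀ z + g₁ z) := sum_le_sum fun z _ => hdom z
    _ = ∑ z, g₀ z + ∑ z, g₁ z := sum_add_distrib
    _ ≤ _ := add_le_add h0 h1

/-- **BI-RADIAL BOUND, PROFILE `A·R/max(R,1)^{d−1+β}`** (`β < 1`): `Σ_z g(z) ≤ 2d3^{d−1}A(n·n^{1−β} + (n+ρ)(n+ρ)^{1−β})`.
[cite: Balaban1983RegularityDecay, (1.9) p.573] -/
theorem biradial_rpow_T (hd : 1 ≤ P.d) (y₀ y₁ : Balaban1983to89.Site P j) (n : ℕ) {A : ℝ} (hA : 0 ≤ A) {β : ℝ} (hβ1 : β < 1)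
    (g : Balaban1983to89.Site P j → ℝ)
    (hg : ∀ z, supDist y₀ z ≤ n → g z ≤ A * ((min (supDist y₀ z) (supDist y₁ z) : ℕ) : ℝ) /
      (max ((min (supDist y₀ z) (supDist y₁ z) : ℕ) : ℝ) 1) ^ ((P.d : ℝ) - 1 + β))
    (hg' : ∀ z, n < supDist y₀ z → g z ≤ 0) :
    ∑ z, g z ≤ 2 * P.d * 3 ^ (P.d - 1) * A * (n * (n : ℝ) ^ (1 - β)) +
      2 * P.d * 3 ^ (P.d - 1) * A * (((n + supDist y₀ y₁ : ℕ) : ℝ) * (((n + supDist y₀ y₁ : ℕ) : ℝ)) ^ (1 - β)) := by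
  set Fb : ℕ → ℝ := fun s => A * (s : ℝ) / (max (s : ℝ) 1) ^ ((P.d : ℝ) - 1 + β) with hFb
  have hFb0 : ∀ s, 0 ≤ Fb s := fun s => by positivity
  set g₀ : Balaban1983to89.Site P j → ℝ := fun z => if supDist y₀ z ≤ n then Fb (supDist y₀ z) else 0 with hg₀
  set g₁ : Balaban1983to89.Site P j → ℝ := fun z => if supDist y₁ z ≤ n + supDist y₀ y₁ then Fb (supDist y₁ z) else 0 with hg₁
  have hdom : ∀ z, g z ≤ g₀ z + g₁ z := fun z => le_two_centres y₀ y₁ n Fb hFb0 g (fun z hz => hg z hz) hg' z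
  have h0 : ∑ z, g₀ z ≤ 2 * P.d * 3 ^ (P.d - 1) * A * (n * (n : ℝ) ^ (1 - β)) :=
    radial_env_rpow_T hd y₀ n hA hβ1 g₀ (fun z hz => by simp only [hg₀]; rw [if_pos hz])
      (fun z hz => by simp only [hg₀]; rw [if_neg (by omega)])
  have h1 : ∑ z, g₁ z ≤ 2 * P.d * 3 ^ (P.d - 1) * A * (((n + supDist y₀ y₁ : ℕ) : ℝ) * (((n + supDist y₀ y₁ : ℕ) : ℝ)) ^ (1 - β)) :=
    radial_env_rpow_T hd y₁ (n + supDist y₀ y₁) hA hβ1 g₁ (fun z hz => by simp only [hg₁]; rw [if_pos hz])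
      (fun z hz => by simp only [hg₁]; rw [if_neg (by omega)])
  calc ∑ z, g z ≤ ∑ z, (g₀ z + g₁ z) := sum_le_sum fun z _ => hdom z
    _ = ∑ z, g₀ z + ∑ z, g₁ z := sum_add_distrib
    _ ≤ _ := add_le_add h0 h1

/-- kernel: `R·A/max(R,1)^{d+β} ≤ A/max(R,1)^{d−1+β}`. [cite: Balaban1983RegularityDecay, (1.9) p.573] -/
theorem T_mul_env_succ_le {T : ℕ} {A β : ℝ} (hA : 0 ≤ A) (d : ℕ) :
    (T : ℝ) * (A / (max (T : ℝ) 1) ^ ((d : ℝ) + β)) ≤ A / (max (T : ℝ) 1) ^ ((d : ℝ) - 1 + β) := by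
  have hm0 : (0 : ℝ) < max (T : ℝ) 1 := by positivity
  have hTm : (T : ℝ) ≤ max (T : ℝ) 1 := le_max_left _ _
  have hp : (max (T : ℝ) 1) ^ ((d : ℝ) + β) = (max (T : ℝ) 1) ^ ((d : ℝ) - 1 + β) * max (T : ℝ) 1 := by
    rw [← Real.rpow_add_one hm0.ne']; congr 1; ring
  rw [hp]
  have hm1 : (0 : ℝ) < (max (T : ℝ) 1) ^ ((d : ℝ) - 1 + β) := Real.rpow_pos_of_pos hm0 _
  calc (T : ℝ) * (A / ((max (T : ℝ) 1) ^ ((d : ℝ) - 1 + β) * max (T : ℝ) 1))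
      = (A / (max (T : ℝ) 1) ^ ((d : ℝ) - 1 + β)) * ((T : ℝ) / max (T : ℝ) 1) := by field_simp
    _ ≤ (A / (max (T : ℝ) 1) ^ ((d : ℝ) - 1 + β)) * 1 := mul_le_mul_of_nonneg_left ((div_le_one hm0).2 hTm) (by positivity)
    _ = _ := mul_one _

end Biradial

/-! ## §2 Algebra: the difference of the two localized representations, the `W`-sum after the per-bond identity -/

section Algebra

variable {P : Params}

/-- kernel: **the per-bond identity** (`ūu = 1`): `(1−u)a ψ₊ + (1−ū)b ψ₋ = (ū−1)a(uψ₊ − ψ₋) + (1−ū)(b − a)ψ₋`.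
[cite: BalabanImbrieJaffe1985, (4.6.2) p.313] -/
theorem per_bond_identity' {u a b ψp ψm : ℂ} (hu : conj u * u = 1) :
    (1 - u) * a * ψp + (1 - conj u) * b * ψm = (conj u - 1) * a * (u * ψp - ψm) + (1 - conj u) * (b - a) * ψm := by
  linear_combination (-(a * ψp)) * hu

/-- kernel: **the reindexed `W`-sum** (`z ↦ z + e_μ` is a bijection of the torus). [cite: BalabanImbrieJaffe1985, (4.6.2) p.313] -/
theorem sum_unshift_reindex' (μ : Fin P.d) (Kt ψ : Balaban1983to89.Site P 0 → ℂ) (u : PBond P 0 → ℂ) :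
    ∑ z : Balaban1983to89.Site P 0, Kt z * ((1 - conj (u ⟨z.unshift μ, μ⟩)) * ψ (z.unshift μ)) =
      ∑ z : Balaban1983to89.Site P 0, Kt (z.shift μ) * ((1 - conj (u ⟨z, μ⟩)) * ψ z) := by
  refine (Fintype.sum_equiv (LatticeFieldCalculus.shiftEquiv μ) _ _ fun z => ?_).symm
  show Kt (z.shift μ) * ((1 - conj (u ⟨z, μ⟩)) * ψ z) =
    Kt (z.shift μ) * ((1 - conj (u ⟨(z.shift μ).unshift μ, μ⟩)) * ψ ((z.shift μ).unshift μ))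
  rw [show (z.shift μ).unshift μ = z from (LatticeFieldCalculus.shiftEquiv μ).left_inv z]

/-- kernel: **the `W`-sum after the per-bond identity** (gen 25's `W_sum_identity`, restated): for `|u| = 1` bondwise,
`Σ_z K̃(z)Σ_μ((1−u_{z,μ})ψ(z+e_μ) + (1−ū_{z−e_μ,μ})ψ(z−e_μ)) = Σ_μΣ_z((ū−1)K̃(z)(uψ(z+e_μ) − ψ(z)) + (1−ū)(K̃(z+e_μ) − K̃(z))ψ(z))`.
[cite: BalabanImbrieJaffe1985, (4.6.2) p.313] -/
theorem W_sum_identity' (Kt ψ : Balaban1983to89.Site P 0 → ℂ) (u : PBond P 0 → ℂ) (hu : ∀ b, conj (u b) * u b = 1) :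
    ∑ z : Balaban1983to89.Site P 0, Kt z * ∑ μ : Fin P.d,
        ((1 - u ⟨z, μ⟩) * ψ (z.shift μ) + (1 - conj (u ⟨z.unshift μ, μ⟩)) * ψ (z.unshift μ)) =
      ∑ μ : Fin P.d, ∑ z : Balaban1983to89.Site P 0,
        ((conj (u ⟨z, μ⟩) - 1) * Kt z * (u ⟨z, μ⟩ * ψ (z.shift μ) - ψ z) +
          (1 - conj (u ⟨z, μ⟩)) * (Kt (z.shift μ) - Kt z) * ψ z) := by
  simp_rw [mul_sum]
  rw [sum_comm]
  refine sum_congr rfl fun μ _ => ?_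
  simp_rw [mul_add]
  rw [sum_add_distrib, sum_unshift_reindex', ← sum_add_distrib]
  refine sum_congr rfl fun z _ => ?_
  have := per_bond_identity' (a := Kt z) (b := Kt (z.shift μ)) (ψp := ψ (z.shift μ)) (ψm := ψ z) (hu ⟨z, μ⟩)
  linear_combination this

/-- **THE DIFFERENCE OF THE LOCALIZED REPRESENTATIONS AT TWO BONDS** `⟨y₀, y₀+e_{μ₀}⟩`, `⟨y₁, y₁+e_{μ₀}⟩` (same real cutoff `χ`, `= 1` at the
four endpoints): with `ΔK(z) = (G♭(y₁+e,z) − G♭(y₁,z)) − (G♭(y₀+e,z) − G♭(y₀,z))`,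
`(ψ(y₁+e) − ψ(y₁)) − (ψ(y₀+e) − ψ(y₀)) = Σ_zΔK χf′ − Σ_zΔK χ((N′ − N♭)ψ) + Σ_z((XN♭ − N♭X)ΔK)ψ` (gen 25's `loc_representation` twice).
[cite: BalabanImbrieJaffe1985, (4.6.2) p.313] -/
theorem loc_representation_pair {a : ℝ} (ha : 0 < a) {k : ℕ} (hk1 : 1 ≤ k) (hk : k ≤ P.m + P.K) (U : GaugeField P 0 U1)
    (ψ f' : Balaban1983to89.Site P 0 → ℂ)
    (hψ : nOp (B1RG242Torus.α P a k * (P.L : ℝ) ^ (k * P.d)) P.eps⁻¹ U k univ *ᵥ ψ = f')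
    (χ : Balaban1983to89.Site P 0 → ℂ) (y₀ y₁ : Balaban1983to89.Site P 0) (μ₀ : Fin P.d) (hχ0 : χ y₀ = 1) (hχ1 : χ (y₀.shift μ₀) = 1)
    (hχ2 : χ y₁ = 1) (hχ3 : χ (y₁.shift μ₀) = 1) :
    (ψ (y₁.shift μ₀) - ψ y₁) - (ψ (y₀.shift μ₀) - ψ y₀) =
      ∑ z, ((gBox (B1RG242Torus.α P a k * (P.L : ℝ) ^ (k * P.d)) P.eps⁻¹ (1 : GaugeField P 0 U1) k univ (y₁.shift μ₀) z -
              gBox (B1RG242Torus.α P a k * (P.L : ℝ) ^ (k * P.d)) P.eps⁻¹ (1 : GaugeField P 0 U1) k univ y₁ z) -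
            (gBox (B1RG242Torus.α P a k * (P.L : ℝ) ^ (k * P.d)) P.eps⁻¹ (1 : GaugeField P 0 U1) k univ (y₀.shift μ₀) z -
              gBox (B1RG242Torus.α P a k * (P.L : ℝ) ^ (k * P.d)) P.eps⁻¹ (1 : GaugeField P 0 U1) k univ y₀ z)) * (χ z * f' z)
      - ∑ z, ((gBox (B1RG242Torus.α P a k * (P.L : ℝ) ^ (k * P.d)) P.eps⁻¹ (1 : GaugeField P 0 U1) k univ (y₁.shift μ₀) z -
              gBox (B1RG242Torus.α P a k * (P.L : ℝ) ^ (k * P.d)) P.eps⁻¹ (1 : GaugeField P 0 U1) k univ y₁ z) -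
            (gBox (B1RG242Torus.α P a k * (P.L : ℝ) ^ (k * P.d)) P.eps⁻¹ (1 : GaugeField P 0 U1) k univ (y₀.shift μ₀) z -
              gBox (B1RG242Torus.α P a k * (P.L : ℝ) ^ (k * P.d)) P.eps⁻¹ (1 : GaugeField P 0 U1) k univ y₀ z)) *
          (χ z * ((nOp (B1RG242Torus.α P a k * (P.L : ℝ) ^ (k * P.d)) P.eps⁻¹ U k univ -
              nOp (B1RG242Torus.α P a k * (P.L : ℝ) ^ (k * P.d)) P.eps⁻¹ (1 : GaugeField P 0 U1) k univ) *ᵥ ψ) z)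
      + ∑ z, ((diagonal χ * nOp (B1RG242Torus.α P a k * (P.L : ℝ) ^ (k * P.d)) P.eps⁻¹ (1 : GaugeField P 0 U1) k univ -
              nOp (B1RG242Torus.α P a k * (P.L : ℝ) ^ (k * P.d)) P.eps⁻¹ (1 : GaugeField P 0 U1) k univ * diagonal χ) *ᵥ
            fun z => (gBox (B1RG242Torus.α P a k * (P.L : ℝ) ^ (k * P.d)) P.eps⁻¹ (1 : GaugeField P 0 U1) k univ (y₁.shift μ₀) z -
              gBox (B1RG242Torus.α P a k * (P.L : ℝ) ^ (k * P.d)) P.eps⁻¹ (1 : GaugeField P 0 U1) k univ y₁ z) -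
            (gBox (B1RG242Torus.α P a k * (P.L : ℝ) ^ (k * P.d)) P.eps⁻¹ (1 : GaugeField P 0 U1) k univ (y₀.shift μ₀) z -
              gBox (B1RG242Torus.α P a k * (P.L : ℝ) ^ (k * P.d)) P.eps⁻¹ (1 : GaugeField P 0 U1) k univ y₀ z)) z * ψ z := by
  have r0 := loc_representation ha hk1 hk U ψ f' hψ χ y₀ μ₀ hχ0 hχ1
  have r1 := loc_representation ha hk1 hk U ψ f' hψ χ y₁ μ₀ hχ2 hχ3
  set Gf := gBox (B1RG242Torus.α P a k * (P.L : ℝ) ^ (k * P.d)) P.eps⁻¹ (1 : GaugeField P 0 U1) k univ with hGf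
  set C := diagonal χ * nOp (B1RG242Torus.α P a k * (P.L : ℝ) ^ (k * P.d)) P.eps⁻¹ (1 : GaugeField P 0 U1) k univ -
    nOp (B1RG242Torus.α P a k * (P.L : ℝ) ^ (k * P.d)) P.eps⁻¹ (1 : GaugeField P 0 U1) k univ * diagonal χ with hC
  set K0 : Balaban1983to89.Site P 0 → ℂ := fun z => Gf (y₀.shift μ₀) z - Gf y₀ z with hK0
  set K1 : Balaban1983to89.Site P 0 → ℂ := fun z => Gf (y₁.shift μ₀) z - Gf y₁ z with hK1
  have hK : (fun z => (Gf (y₁.shift μ₀) z - Gf y₁ z) - (Gf (y₀.shift μ₀) z - Gf y₀ z)) = K1 - K0 := by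
    funext z; simp only [hK0, hK1, Pi.sub_apply]
  rw [r1, r0, hK, mulVec_sub]
  simp only [Pi.sub_apply, sub_mul, sum_sub_distrib, hK0, hK1]
  ring

end Algebra

/-! ## §3 The term bounds with the bi-radial Hölder envelopes, and THE LOCAL TWO-BOND INTERIOR ESTIMATE -/

section Powers

/-- kernel: `x^{d−1+α} = x^{d−1}·x^α` (`x > 0`, `d ≥ 1`). [cite: Balaban1983RegularityDecay, (1.9) p.573] -/
theorem rpow_pred_add {x : ℝ} (hx : 0 < x) {d : ℕ} (hd : 1 ≤ d) (α : ℝ) : x ^ ((d : ℝ) - 1 + α) = x ^ (d - 1) * x ^ α := by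
  rw [Real.rpow_add hx, ← Real.rpow_natCast, Nat.cast_sub hd, Nat.cast_one]

/-- kernel: `x^{d+α} = x^d·x^α` (`x > 0`). [cite: Balaban1983RegularityDecay, (1.9) p.573] -/
theorem rpow_nat_add {x : ℝ} (hx : 0 < x) (d : ℕ) (α : ℝ) : x ^ ((d : ℝ) + α) = x ^ d * x ^ α := by
  rw [Real.rpow_add hx, Real.rpow_natCast]

/-- kernel: `(cx)^e ≤ c·x^e` for `c ≥ 1`, `x ≥ 0`, `0 ≤ e ≤ 1`. [cite: Balaban1983RegularityDecay, (1.9) p.573] -/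
theorem mul_rpow_le_mul {c x e : ℝ} (hc : 1 ≤ c) (hx : 0 ≤ x) (he1 : e ≤ 1) : (c * x) ^ e ≤ c * x ^ e := by
  rw [Real.mul_rpow (by linarith) hx]
  refine mul_le_mul_of_nonneg_right ?_ (Real.rpow_nonneg hx e)
  calc c ^ e ≤ c ^ (1 : ℝ) := Real.rpow_le_rpow_of_exponent_le hc he1
    _ = c := Real.rpow_one c

/-- kernel: monotonicity `x^e ≤ y^e` for `0 ≤ x ≤ y`, `e ≥ 0`, in the form `x^e ≤ c·y^e` for `x ≤ cy`, `c ≥ 1`, `e ≤ 1`.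
[cite: Balaban1983RegularityDecay, (1.9) p.573] -/
theorem rpow_le_mul_rpow {c x y e : ℝ} (hc : 1 ≤ c) (hx : 0 ≤ x) (hy : 0 ≤ y) (hxy : x ≤ c * y) (he0 : 0 ≤ e) (he1 : e ≤ 1) :
    x ^ e ≤ c * y ^ e :=
  (Real.rpow_le_rpow hx hxy he0).trans (mul_rpow_le_mul hc hy he1)

/-- kernel: `(2/r)^α ≤ 2·r^{−α}` (`r > 0`, `0 ≤ α ≤ 1`). [cite: Balaban1983RegularityDecay, (1.9) p.573] -/
theorem two_div_rpow_le {r α : ℝ} (hr : 0 < r) (hα1 : α ≤ 1) : (2 / r) ^ α ≤ 2 * r ^ (-α) := by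
  rw [div_eq_mul_inv, Real.mul_rpow zero_le_two (inv_nonneg.2 hr.le), Real.inv_rpow hr.le, Real.rpow_neg hr.le]
  refine mul_le_mul_of_nonneg_right ?_ (inv_nonneg.2 (Real.rpow_nonneg hr.le α))
  calc (2 : ℝ) ^ α ≤ 2 ^ (1 : ℝ) := Real.rpow_le_rpow_of_exponent_le one_le_two hα1
    _ = 2 := Real.rpow_one 2

end Powers

section Local

variable {P : Params}

open BIJ85BlockAveragesTorus BIJ85BlockAveragesTorusK

/-- **THE `χ`-WEIGHTED KERNEL SUM** with the bi-radial Hölder envelope: `‖Σ_z K(z)χ(z)w(z)‖ ≤ W·(two-centre radial bound)` when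
`‖K‖ ≤ A/max(R,1)^{d−1+α}` and `‖w‖ ≤ W` on the ball `|z−y₀|_∞ < 2r`. [cite: BalabanImbrieJaffe1985, p.326] -/
theorem chi_weighted_sum_le' (hd : 1 ≤ P.d) {r : ℕ} (hr : 1 ≤ r) (y₀ y₁ : Balaban1983to89.Site P 0)
    (K w : Balaban1983to89.Site P 0 → ℂ) {A W α : ℝ} (hA : 0 ≤ A) (hW : 0 ≤ W) (hα0 : 0 ≤ α) (hα1 : α < 1)
    (hK : ∀ z, ‖K z‖ ≤ A / (max ((min (supDist y₀ z) (supDist y₁ z) : ℕ) : ℝ) 1) ^ ((P.d : ℝ) - 1 + α))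
    (hw : ∀ z, supDist y₀ z < 2 * r → ‖w z‖ ≤ W) :
    ‖∑ z, K z * (((chi y₀ r z : ℝ) : ℂ) * w z)‖ ≤
      W * (A * (1 + 2 * P.d * 3 ^ (P.d - 1) * (((2 * r : ℕ) : ℝ) ^ (1 - α) / (1 - α))) +
        A * (1 + 2 * P.d * 3 ^ (P.d - 1) * ((((2 * r + supDist y₀ y₁ : ℕ) : ℝ)) ^ (1 - α) / (1 - α)))) := by
  refine (norm_sum_le _ _).trans ?_
  have hin : ∀ z, supDist y₀ z ≤ 2 * r → ‖K z * (((chi y₀ r z : ℝ) : ℂ) * w z)‖ ≤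
      W * A / (max ((min (supDist y₀ z) (supDist y₁ z) : ℕ) : ℝ) 1) ^ ((P.d : ℝ) - 1 + α) := by
    intro z _
    have hχ0 := chi_nonneg y₀ r z
    rw [norm_mul, norm_mul, Complex.norm_real, Real.norm_of_nonneg hχ0]
    by_cases h0 : chi y₀ r z = 0
    · rw [h0, zero_mul, mul_zero]; positivity
    · have hT := supDist_lt_of_chi_ne_zero hr h0
      calc ‖K z‖ * (chi y₀ r z * ‖w z‖) ≤ (A / (max ((min (supDist y₀ z) (supDist y₁ z) : ℕ) : ℝ) 1) ^ ((P.d : ℝ) - 1 + α)) * (1 * W) :=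
            mul_le_mul (hK z) (mul_le_mul (chi_le_one hr y₀ z) (hw z hT) (norm_nonneg _) zero_le_one)
              (mul_nonneg hχ0 (norm_nonneg _)) (by positivity)
        _ = W * A / (max ((min (supDist y₀ z) (supDist y₁ z) : ℕ) : ℝ) 1) ^ ((P.d : ℝ) - 1 + α) := by ring
  have hout : ∀ z, 2 * r < supDist y₀ z → ‖K z * (((chi y₀ r z : ℝ) : ℂ) * w z)‖ ≤ 0 := by
    intro z hz
    have h0 : chi y₀ r z = 0 := by
      by_contra h0; have := supDist_lt_of_chi_ne_zero hr h0; omega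
    rw [h0]; simp
  have hmain := biradial_rpow hd y₀ y₁ (2 * r) (A := W * A) (by positivity) hα0 hα1 _ hin hout
  linarith [hmain]

/-- **THE `W`-TERM** (the per-bond identity summed) with the BI-CENTRED gauge weight `|1 − u_{z,μ}| ≤ γR(z)` on the ball `|z−y₀|_∞ ≤ 2r`,
`‖uψ(z+e_μ) − ψ(z)‖ ≤ M`, `‖ψ‖ ≤ S` there, and the two Hölder envelopes: the `R`-weight vanishes at BOTH kernel singularities, so the sums are
the convergent `Σ_s s^{1−α}`, `Σ_s s^{−α}` around each centre. [cite: BalabanImbrieJaffe1985, p.326] -/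
theorem W_term_le' (hd : 1 ≤ P.d) {r : ℕ} (hr : 1 ≤ r) (hN : 4 * r + 6 ≤ P.sitesPerDir 0) (y₀ y₁ : Balaban1983to89.Site P 0)
    (K ψ : Balaban1983to89.Site P 0 → ℂ) (u : PBond P 0 → ℂ) {A γ S M α : ℝ} (hA : 0 ≤ A) (hγ : 0 ≤ γ) (hS : 0 ≤ S) (hM : 0 ≤ M)
    (hα0 : 0 ≤ α) (hα1 : α < 1)
    (hK1 : ∀ z, ‖K z‖ ≤ A / (max ((min (supDist y₀ z) (supDist y₁ z) : ℕ) : ℝ) 1) ^ ((P.d : ℝ) - 1 + α))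
    (hK2 : ∀ z ν, ‖K (z.shift ν) - K z‖ ≤ A / (max ((min (supDist y₀ z) (supDist y₁ z) : ℕ) : ℝ) 1) ^ ((P.d : ℝ) + α))
    (hu : ∀ z μ, supDist y₀ z ≤ 2 * r → ‖u ⟨z, μ⟩ - 1‖ ≤ γ * ((min (supDist y₀ z) (supDist y₁ z) : ℕ) : ℝ))
    (hψS : ∀ z, supDist y₀ z ≤ 2 * r → ‖ψ z‖ ≤ S)
    (hψM : ∀ z μ, supDist y₀ z ≤ 2 * r → ‖u ⟨z, μ⟩ * ψ (z.shift μ) - ψ z‖ ≤ M) :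
    ‖∑ μ : Fin P.d, ∑ z : Balaban1983to89.Site P 0,
        ((conj (u ⟨z, μ⟩) - 1) * (((chi y₀ r z : ℝ) : ℂ) * K z) * (u ⟨z, μ⟩ * ψ (z.shift μ) - ψ z) +
          (1 - conj (u ⟨z, μ⟩)) * ((((chi y₀ r (z.shift μ) : ℝ) : ℂ) * K (z.shift μ)) - (((chi y₀ r z : ℝ) : ℂ) * K z)) * ψ z)‖ ≤
      P.d * (2 * P.d * 3 ^ (P.d - 1) * (γ * (A * (M + 2 ^ ((P.d : ℝ) - 1 + α) * S / r))) *
          ((2 * r : ℕ) * ((2 * r : ℕ) : ℝ) ^ (1 - α)) +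
        2 * P.d * 3 ^ (P.d - 1) * (γ * (A * (M + 2 ^ ((P.d : ℝ) - 1 + α) * S / r))) *
          (((2 * r + supDist y₀ y₁ : ℕ) : ℝ) * (((2 * r + supDist y₀ y₁ : ℕ) : ℝ)) ^ (1 - α)) +
        (γ * (A * S) * (1 + 2 * P.d * 3 ^ (P.d - 1) * (((2 * r : ℕ) : ℝ) ^ (1 - α) / (1 - α))) +
          γ * (A * S) * (1 + 2 * P.d * 3 ^ (P.d - 1) * ((((2 * r + supDist y₀ y₁ : ℕ) : ℝ)) ^ (1 - α) / (1 - α))))) := by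
  have hr0 : (0 : ℝ) < r := by exact_mod_cast hr
  have hexp : 0 ≤ (P.d : ℝ) - 1 + α := by
    have : (1 : ℝ) ≤ P.d := by exact_mod_cast hd
    linarith
  refine (norm_sum_le _ _).trans ?_
  have hμ : ∀ μ : Fin P.d, ‖∑ z : Balaban1983to89.Site P 0,
      ((conj (u ⟨z, μ⟩) - 1) * (((chi y₀ r z : ℝ) : ℂ) * K z) * (u ⟨z, μ⟩ * ψ (z.shift μ) - ψ z) +
        (1 - conj (u ⟨z, μ⟩)) * ((((chi y₀ r (z.shift μ) : ℝ) : ℂ) * K (z.shift μ)) - (((chi y₀ r z : ℝ) : ℂ) * K z)) * ψ z)‖ ≤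
      2 * P.d * 3 ^ (P.d - 1) * (γ * (A * (M + 2 ^ ((P.d : ℝ) - 1 + α) * S / r))) *
          ((2 * r : ℕ) * ((2 * r : ℕ) : ℝ) ^ (1 - α)) +
        2 * P.d * 3 ^ (P.d - 1) * (γ * (A * (M + 2 ^ ((P.d : ℝ) - 1 + α) * S / r))) *
          (((2 * r + supDist y₀ y₁ : ℕ) : ℝ) * (((2 * r + supDist y₀ y₁ : ℕ) : ℝ)) ^ (1 - α)) +
        (γ * (A * S) * (1 + 2 * P.d * 3 ^ (P.d - 1) * (((2 * r : ℕ) : ℝ) ^ (1 - α) / (1 - α))) +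
          γ * (A * S) * (1 + 2 * P.d * 3 ^ (P.d - 1) * ((((2 * r + supDist y₀ y₁ : ℕ) : ℝ)) ^ (1 - α) / (1 - α)))) := by
    intro μ
    -- the two majorants
    set p1 : Balaban1983to89.Site P 0 → ℝ := fun z => ‖u ⟨z, μ⟩ - 1‖ *
      (chi y₀ r z * ‖K z‖ * ‖u ⟨z, μ⟩ * ψ (z.shift μ) - ψ z‖ + |chi y₀ r (z.shift μ) - chi y₀ r z| * ‖K (z.shift μ)‖ * ‖ψ z‖) with hp1
    set p2 : Balaban1983to89.Site P 0 → ℝ := fun z => ‖u ⟨z, μ⟩ - 1‖ * (chi y₀ r z * ‖K (z.shift μ) - K z‖ * ‖ψ z‖) with hp2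
    -- pointwise splitting (verbatim from gen 25)
    have hpt : ∀ z, ‖(conj (u ⟨z, μ⟩) - 1) * (((chi y₀ r z : ℝ) : ℂ) * K z) * (u ⟨z, μ⟩ * ψ (z.shift μ) - ψ z) +
        (1 - conj (u ⟨z, μ⟩)) * ((((chi y₀ r (z.shift μ) : ℝ) : ℂ) * K (z.shift μ)) - (((chi y₀ r z : ℝ) : ℂ) * K z)) * ψ z‖ ≤
        p1 z + p2 z := by
      intro z
      have hχ0 := chi_nonneg y₀ r z
      have hn1 : ‖conj (u ⟨z, μ⟩) - 1‖ = ‖u ⟨z, μ⟩ - 1‖ := by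
        rw [← Complex.norm_conj, map_sub, Complex.conj_conj, map_one]
      have hn2 : ‖1 - conj (u ⟨z, μ⟩)‖ = ‖u ⟨z, μ⟩ - 1‖ := by rw [norm_sub_rev, hn1]
      have e1 : ‖(conj (u ⟨z, μ⟩) - 1) * (((chi y₀ r z : ℝ) : ℂ) * K z) * (u ⟨z, μ⟩ * ψ (z.shift μ) - ψ z)‖ =
          ‖u ⟨z, μ⟩ - 1‖ * (chi y₀ r z * ‖K z‖) * ‖u ⟨z, μ⟩ * ψ (z.shift μ) - ψ z‖ := by
        rw [norm_mul, norm_mul, norm_mul, hn1, Complex.norm_real, Real.norm_of_nonneg hχ0]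
      have e2 : ‖(1 - conj (u ⟨z, μ⟩)) * ((((chi y₀ r (z.shift μ) : ℝ) : ℂ) * K (z.shift μ)) - (((chi y₀ r z : ℝ) : ℂ) * K z)) * ψ z‖ =
          ‖u ⟨z, μ⟩ - 1‖ * ‖(((chi y₀ r (z.shift μ) : ℝ) : ℂ) * K (z.shift μ)) - (((chi y₀ r z : ℝ) : ℂ) * K z)‖ * ‖ψ z‖ := by
        rw [norm_mul, norm_mul, hn2]
      have h3 : ‖(((chi y₀ r (z.shift μ) : ℝ) : ℂ) * K (z.shift μ)) - (((chi y₀ r z : ℝ) : ℂ) * K z)‖ ≤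
          |chi y₀ r (z.shift μ) - chi y₀ r z| * ‖K (z.shift μ)‖ + chi y₀ r z * ‖K (z.shift μ) - K z‖ := by
        have hsplit : (((chi y₀ r (z.shift μ) : ℝ) : ℂ) * K (z.shift μ)) - (((chi y₀ r z : ℝ) : ℂ) * K z) =
            (((chi y₀ r (z.shift μ) : ℝ) : ℂ) - ((chi y₀ r z : ℝ) : ℂ)) * K (z.shift μ) + ((chi y₀ r z : ℝ) : ℂ) * (K (z.shift μ) - K z) := by
          ring
        rw [hsplit]
        refine (norm_add_le _ _).trans (le_of_eq ?_)
        rw [norm_mul, norm_mul, ← Complex.ofReal_sub, Complex.norm_real, Complex.norm_real, Real.norm_eq_abs,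
          Real.norm_of_nonneg hχ0]
      calc _ ≤ _ := norm_add_le _ _
        _ = ‖u ⟨z, μ⟩ - 1‖ * (chi y₀ r z * ‖K z‖) * ‖u ⟨z, μ⟩ * ψ (z.shift μ) - ψ z‖ +
            ‖u ⟨z, μ⟩ - 1‖ * ‖(((chi y₀ r (z.shift μ) : ℝ) : ℂ) * K (z.shift μ)) - (((chi y₀ r z : ℝ) : ℂ) * K z)‖ * ‖ψ z‖ := by
            rw [e1, e2]
        _ ≤ ‖u ⟨z, μ⟩ - 1‖ * (chi y₀ r z * ‖K z‖) * ‖u ⟨z, μ⟩ * ψ (z.shift μ) - ψ z‖ +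
            ‖u ⟨z, μ⟩ - 1‖ * (|chi y₀ r (z.shift μ) - chi y₀ r z| * ‖K (z.shift μ)‖ + chi y₀ r z * ‖K (z.shift μ) - K z‖) * ‖ψ z‖ := by
            gcongr
        _ = p1 z + p2 z := by simp only [hp1, hp2]; ring
    -- profile `R`: pointwise bound of `p1`
    have hP1 : ∀ z, supDist y₀ z ≤ 2 * r →
        p1 z ≤ γ * (A * (M + 2 ^ ((P.d : ℝ) - 1 + α) * S / r)) * ((min (supDist y₀ z) (supDist y₁ z) : ℕ) : ℝ) /
          (max ((min (supDist y₀ z) (supDist y₁ z) : ℕ) : ℝ) 1) ^ ((P.d : ℝ) - 1 + α) := by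
      intro z hz
      have hu' := hu z μ hz
      have hKz := hK1 z
      have hKs : ‖K (z.shift μ)‖ ≤ 2 ^ ((P.d : ℝ) - 1 + α) * A / (max ((min (supDist y₀ z) (supDist y₁ z) : ℕ) : ℝ) 1) ^ ((P.d : ℝ) - 1 + α) :=
        (hK1 (z.shift μ)).trans (env_neighbour_rpow (minDist_le_shift_succ y₀ y₁ z μ) hexp hA)
      have hχ1 := chi_le_one hr y₀ z
      have hχ0 := chi_nonneg y₀ r z
      have hdχ := abs_chi_shift_sub_le hr hN y₀ z μ
      have hMz := hψM z μ hz
      have hSz := hψS z hz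
      have hm : 0 < (max ((min (supDist y₀ z) (supDist y₁ z) : ℕ) : ℝ) 1) ^ ((P.d : ℝ) - 1 + α) := by positivity
      have step1 : chi y₀ r z * ‖K z‖ * ‖u ⟨z, μ⟩ * ψ (z.shift μ) - ψ z‖ ≤
          1 * (A / (max ((min (supDist y₀ z) (supDist y₁ z) : ℕ) : ℝ) 1) ^ ((P.d : ℝ) - 1 + α)) * M := by
        gcongr
      have step2 : |chi y₀ r (z.shift μ) - chi y₀ r z| * ‖K (z.shift μ)‖ * ‖ψ z‖ ≤
          (1 / r) * (2 ^ ((P.d : ℝ) - 1 + α) * A / (max ((min (supDist y₀ z) (supDist y₁ z) : ℕ) : ℝ) 1) ^ ((P.d : ℝ) - 1 + α)) * S := by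
        gcongr
      have step3 : p1 z ≤ (γ * ((min (supDist y₀ z) (supDist y₁ z) : ℕ) : ℝ)) *
          (1 * (A / (max ((min (supDist y₀ z) (supDist y₁ z) : ℕ) : ℝ) 1) ^ ((P.d : ℝ) - 1 + α)) * M +
          (1 / r) * (2 ^ ((P.d : ℝ) - 1 + α) * A / (max ((min (supDist y₀ z) (supDist y₁ z) : ℕ) : ℝ) 1) ^ ((P.d : ℝ) - 1 + α)) * S) := by
        simp only [hp1]
        exact mul_le_mul hu' (add_le_add step1 step2) (add_nonneg (by positivity) (by positivity)) (by positivity)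
      refine step3.trans (le_of_eq ?_)
      field_simp
    have hP1' : ∀ z, 2 * r < supDist y₀ z → p1 z ≤ 0 := by
      intro z hz
      have h0 : chi y₀ r z = 0 := by
        by_contra h0; have := supDist_lt_of_chi_ne_zero hr h0; omega
      have h1 : chi y₀ r (z.shift μ) = 0 := by
        by_contra h1; have := supDist_lt_of_chi_ne_zero hr h1; have := supDist_le_shift_succ y₀ z μ; omega
      simp only [hp1]; rw [h0, h1]; simp
    -- profile `1`: pointwise bound of `p2` (`R/max(R,1)^{d+α} ≤ 1/max(R,1)^{d−1+α}`)
    have hP2 : ∀ z, supDist y₀ z ≤ 2 * r →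
        p2 z ≤ γ * (A * S) / (max ((min (supDist y₀ z) (supDist y₁ z) : ℕ) : ℝ) 1) ^ ((P.d : ℝ) - 1 + α) := by
      intro z hz
      have hu' := hu z μ hz
      have hχ1 := chi_le_one hr y₀ z
      have hχ0 := chi_nonneg y₀ r z
      have hSz := hψS z hz
      have hK2z := hK2 z μ
      have hkey := T_mul_env_succ_le (T := min (supDist y₀ z) (supDist y₁ z)) (β := α) hA P.d
      have step : p2 z ≤ (γ * ((min (supDist y₀ z) (supDist y₁ z) : ℕ) : ℝ)) *
          (1 * (A / (max ((min (supDist y₀ z) (supDist y₁ z) : ℕ) : ℝ) 1) ^ ((P.d : ℝ) + α)) * S) := by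
        simp only [hp2]; gcongr
      calc p2 z ≤ _ := step
        _ = γ * S * (((min (supDist y₀ z) (supDist y₁ z) : ℕ) : ℝ) *
            (A / (max ((min (supDist y₀ z) (supDist y₁ z) : ℕ) : ℝ) 1) ^ ((P.d : ℝ) + α))) := by ring
        _ ≤ γ * S * (A / (max ((min (supDist y₀ z) (supDist y₁ z) : ℕ) : ℝ) 1) ^ ((P.d : ℝ) - 1 + α)) :=
            mul_le_mul_of_nonneg_left hkey (by positivity)
        _ = _ := by ring
    have hP2' : ∀ z, 2 * r < supDist y₀ z → p2 z ≤ 0 := by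
      intro z hz
      have h0 : chi y₀ r z = 0 := by
        by_contra h0; have := supDist_lt_of_chi_ne_zero hr h0; omega
      simp only [hp2]; rw [h0]; simp
    have hTsum := biradial_rpow_T hd y₀ y₁ (2 * r) (A := γ * (A * (M + 2 ^ ((P.d : ℝ) - 1 + α) * S / r))) (by positivity) hα1 p1 hP1 hP1'
    have h1sum := biradial_rpow hd y₀ y₁ (2 * r) (A := γ * (A * S)) (by positivity) hα0 hα1 p2 hP2 hP2'
    calc _ ≤ ∑ z, (p1 z + p2 z) := (norm_sum_le _ _).trans (sum_le_sum fun z _ => hpt z)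
      _ = ∑ z, p1 z + ∑ z, p2 z := sum_add_distrib
      _ ≤ _ := add_le_add hTsum h1sum
  calc ∑ μ : Fin P.d, ‖∑ z : Balaban1983to89.Site P 0,
        ((conj (u ⟨z, μ⟩) - 1) * (((chi y₀ r z : ℝ) : ℂ) * K z) * (u ⟨z, μ⟩ * ψ (z.shift μ) - ψ z) +
          (1 - conj (u ⟨z, μ⟩)) * ((((chi y₀ r (z.shift μ) : ℝ) : ℂ) * K (z.shift μ)) - (((chi y₀ r z : ℝ) : ℂ) * K z)) * ψ z)‖
      ≤ ∑ _μ : Fin P.d, (2 * P.d * 3 ^ (P.d - 1) * (γ * (A * (M + 2 ^ ((P.d : ℝ) - 1 + α) * S / r))) *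
          ((2 * r : ℕ) * ((2 * r : ℕ) : ℝ) ^ (1 - α)) +
        2 * P.d * 3 ^ (P.d - 1) * (γ * (A * (M + 2 ^ ((P.d : ℝ) - 1 + α) * S / r))) *
          (((2 * r + supDist y₀ y₁ : ℕ) : ℝ) * (((2 * r + supDist y₀ y₁ : ℕ) : ℝ)) ^ (1 - α)) +
        (γ * (A * S) * (1 + 2 * P.d * 3 ^ (P.d - 1) * (((2 * r : ℕ) : ℝ) ^ (1 - α) / (1 - α))) +
          γ * (A * S) * (1 + 2 * P.d * 3 ^ (P.d - 1) * ((((2 * r + supDist y₀ y₁ : ℕ) : ℝ)) ^ (1 - α) / (1 - α))))) :=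
        sum_le_sum fun μ _ => hμ μ
    _ = _ := by rw [sum_const, card_univ, Fintype.card_fin, nsmul_eq_mul]

/-- **THE LAPLACIAN PART OF THE COMMUTATOR** (summation by parts onto the cutoff) with the bi-radial Hölder envelopes: on the support of the
differences of `χ` (`|z−y₀|_∞ ≥ r − 2`) one has `R ≥ r/2` (`2|y₀−y₁|_∞ + 4 ≤ r`), so `|K| ≤ A(2/r)^{d−1+α}`, `|∇K| ≤ A(2/r)^{d+α}` there and
`‖Σ_z(Σ_μ((χ(z+e_μ) − χ(z))K(z+e_μ) + (χ(z−e_μ) − χ(z))K(z−e_μ)))ψ(z)‖ ≤ d·A·S·(8·9^{d−1} + 2·10^d)(2/r)^α/r` — the Hölder gain `(2/r)^α`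
kept. [cite: BalabanImbrieJaffe1985, p.326] -/
theorem commLap_le' (hd : 1 ≤ P.d) {r : ℕ} (hr : 4 ≤ r) (hN : 4 * r + 6 ≤ P.sitesPerDir 0) (y₀ y₁ : Balaban1983to89.Site P 0)
    (hρ : 2 * supDist y₀ y₁ + 4 ≤ r) (K ψ : Balaban1983to89.Site P 0 → ℂ) {A S α : ℝ} (hA : 0 ≤ A) (hS : 0 ≤ S) (hα0 : 0 ≤ α)
    (hK1 : ∀ z, ‖K z‖ ≤ A / (max ((min (supDist y₀ z) (supDist y₁ z) : ℕ) : ℝ) 1) ^ ((P.d : ℝ) - 1 + α))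
    (hK2 : ∀ z ν, ‖K (z.shift ν) - K z‖ ≤ A / (max ((min (supDist y₀ z) (supDist y₁ z) : ℕ) : ℝ) 1) ^ ((P.d : ℝ) + α))
    (hψS : ∀ z, supDist y₀ z ≤ 2 * r + 1 → ‖ψ z‖ ≤ S) :
    ‖∑ z : Balaban1983to89.Site P 0, (∑ μ : Fin P.d,
        ((((chi y₀ r (z.shift μ) : ℝ) : ℂ) - ((chi y₀ r z : ℝ) : ℂ)) * K (z.shift μ) +
          (((chi y₀ r (z.unshift μ) : ℝ) : ℂ) - ((chi y₀ r z : ℝ) : ℂ)) * K (z.unshift μ))) * ψ z‖ ≤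
      P.d * (A * S * (8 * 9 ^ (P.d - 1) + 2 * 10 ^ P.d) * (2 / (r : ℝ)) ^ α / r) := by
  classical
  have hr1 : 1 ≤ r := by omega
  have hr0 : (0 : ℝ) < r := by exact_mod_cast (show 0 < r by omega)
  have h2r : (0 : ℝ) < 2 / r := by positivity
  have hexp1 : 0 ≤ (P.d : ℝ) - 1 + α := by
    have : (1 : ℝ) ≤ P.d := by exact_mod_cast hd
    linarith
  have hexp2 : 0 ≤ (P.d : ℝ) + α := by positivity
  have hgain : 0 ≤ (2 / (r : ℝ)) ^ α := Real.rpow_nonneg h2r.le α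
  -- reduce to one direction
  have hμ : ∀ μ : Fin P.d, ∑ z : Balaban1983to89.Site P 0,
      ‖((((chi y₀ r (z.shift μ) : ℝ) : ℂ) - ((chi y₀ r z : ℝ) : ℂ)) * K (z.shift μ) +
          (((chi y₀ r (z.unshift μ) : ℝ) : ℂ) - ((chi y₀ r z : ℝ) : ℂ)) * K (z.unshift μ))‖ * ‖ψ z‖ ≤
      A * S * (8 * 9 ^ (P.d - 1) + 2 * 10 ^ P.d) * (2 / (r : ℝ)) ^ α / r := by
    intro μ
    set q1 : Balaban1983to89.Site P 0 → ℝ := fun z =>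
      |chi y₀ r (z.shift μ) - 2 * chi y₀ r z + chi y₀ r (z.unshift μ)| * ‖K (z.shift μ)‖ * ‖ψ z‖ with hq1
    set q2 : Balaban1983to89.Site P 0 → ℝ := fun z =>
      |chi y₀ r z - chi y₀ r (z.unshift μ)| * (‖K (z.shift μ) - K z‖ + ‖K ((z.unshift μ).shift μ) - K (z.unshift μ)‖) * ‖ψ z‖ with hq2
    have hzs : ∀ z : Balaban1983to89.Site P 0, (z.unshift μ).shift μ = z := fun z => (LatticeFieldCalculus.shiftEquiv μ).right_inv z
    have hpt : ∀ z, ‖((((chi y₀ r (z.shift μ) : ℝ) : ℂ) - ((chi y₀ r z : ℝ) : ℂ)) * K (z.shift μ) +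
        (((chi y₀ r (z.unshift μ) : ℝ) : ℂ) - ((chi y₀ r z : ℝ) : ℂ)) * K (z.unshift μ))‖ * ‖ψ z‖ ≤ q1 z + q2 z := by
      intro z
      have e : (((chi y₀ r (z.shift μ) : ℝ) : ℂ) - ((chi y₀ r z : ℝ) : ℂ)) * K (z.shift μ) +
          (((chi y₀ r (z.unshift μ) : ℝ) : ℂ) - ((chi y₀ r z : ℝ) : ℂ)) * K (z.unshift μ) =
          (((chi y₀ r (z.shift μ) - 2 * chi y₀ r z + chi y₀ r (z.unshift μ) : ℝ) : ℂ)) * K (z.shift μ) +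
            ((chi y₀ r z - chi y₀ r (z.unshift μ) : ℝ) : ℂ) * (K (z.shift μ) - K ((z.unshift μ).shift μ) +
              (K ((z.unshift μ).shift μ) - K (z.unshift μ))) := by
        rw [hzs]; push_cast; ring
      rw [e]
      have h1 : ‖(((chi y₀ r (z.shift μ) - 2 * chi y₀ r z + chi y₀ r (z.unshift μ) : ℝ) : ℂ)) * K (z.shift μ)‖ =
          |chi y₀ r (z.shift μ) - 2 * chi y₀ r z + chi y₀ r (z.unshift μ)| * ‖K (z.shift μ)‖ := by
        rw [norm_mul, Complex.norm_real, Real.norm_eq_abs]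
      have h2 : ‖((chi y₀ r z - chi y₀ r (z.unshift μ) : ℝ) : ℂ) * (K (z.shift μ) - K ((z.unshift μ).shift μ) +
          (K ((z.unshift μ).shift μ) - K (z.unshift μ)))‖ ≤
          |chi y₀ r z - chi y₀ r (z.unshift μ)| * (‖K (z.shift μ) - K z‖ + ‖K ((z.unshift μ).shift μ) - K (z.unshift μ)‖) := by
        rw [norm_mul, Complex.norm_real, Real.norm_eq_abs]
        refine mul_le_mul_of_nonneg_left ((norm_add_le _ _).trans (by rw [hzs])) (abs_nonneg _)
      calc _ ≤ (‖(((chi y₀ r (z.shift μ) - 2 * chi y₀ r z + chi y₀ r (z.unshift μ) : ℝ) : ℂ)) * K (z.shift μ)‖ +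
            ‖((chi y₀ r z - chi y₀ r (z.unshift μ) : ℝ) : ℂ) * (K (z.shift μ) - K ((z.unshift μ).shift μ) +
              (K ((z.unshift μ).shift μ) - K (z.unshift μ)))‖) * ‖ψ z‖ :=
            mul_le_mul_of_nonneg_right (norm_add_le _ _) (norm_nonneg _)
        _ ≤ (|chi y₀ r (z.shift μ) - 2 * chi y₀ r z + chi y₀ r (z.unshift μ)| * ‖K (z.shift μ)‖ +
            |chi y₀ r z - chi y₀ r (z.unshift μ)| * (‖K (z.shift μ) - K z‖ + ‖K ((z.unshift μ).shift μ) - K (z.unshift μ)‖)) * ‖ψ z‖ := by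
            rw [h1]; gcongr
        _ = q1 z + q2 z := by simp only [hq1, hq2]; ring
    -- the kink slabs
    set Sl : Finset (Balaban1983to89.Site P 0) := slab y₀ (2 * r) μ r ∪ slab y₀ (2 * r) μ (2 * r) with hSl
    have hB1 : (0 : ℝ) ≤ 2 / r * (A * (2 / (r : ℝ)) ^ ((P.d : ℝ) - 1 + α)) * S := by positivity
    have hq1pt : ∀ z, q1 z ≤ if z ∈ Sl then 2 / r * (A * (2 / (r : ℝ)) ^ ((P.d : ℝ) - 1 + α)) * S else 0 := by
      intro z
      split_ifs with hz
      · have hz' : supDist y₀ z ≤ 2 * r ∧ (cdist (z μ - y₀ μ) = r ∨ cdist (z μ - y₀ μ) = 2 * r) := by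
          rw [hSl, mem_union, mem_slab, mem_slab] at hz
          rcases hz with h | h
          · exact ⟨h.1, Or.inl h.2⟩
          · exact ⟨h.1, Or.inr h.2⟩
        have hTz : r ≤ supDist y₀ z := by
          have h1 : cdist (z μ - y₀ μ) ≤ supDist y₀ z := by rw [cdist_sub_comm]; exact cdist_le_supDist y₀ z μ
          rcases hz'.2 with h | h <;> omega
        have hT' : (r : ℝ) / 2 ≤ ((min (supDist y₀ (z.shift μ)) (supDist y₁ (z.shift μ)) : ℕ) : ℝ) := by
          refine half_le_minDist hρ ?_
          have := supDist_le_shift_succ y₀ z μ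
          omega
        have hKs : ‖K (z.shift μ)‖ ≤ A * (2 / (r : ℝ)) ^ ((P.d : ℝ) - 1 + α) := (hK1 _).trans (env_far_rpow hr0 hT' hexp1 hA)
        have hdd := abs_chi_second_diff_le hr1 hN y₀ z μ
        have hψz := hψS z (by omega)
        simp only [hq1]
        gcongr
      · have h0 : chi y₀ r (z.shift μ) - 2 * chi y₀ r z + chi y₀ r (z.unshift μ) = 0 := by
          by_contra h0
          have h1 := cdist_eq_of_chi_second_diff_ne_zero hr1 hN h0
          have h2 := supDist_le_of_chi_second_diff_ne_zero hr1 h0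
          apply hz
          rw [hSl, mem_union, mem_slab, mem_slab]
          rcases h1 with h | h
          · exact Or.inl ⟨h2, h⟩
          · exact Or.inr ⟨h2, h⟩
        simp only [hq1]; rw [h0]; simp
    have hcardSl : (Sl.card : ℝ) ≤ 4 * (4 * r + 1) ^ (P.d - 1) := by
      have h1 := card_slab_le y₀ (2 * r) μ r
      have h2 := card_slab_le y₀ (2 * r) μ (2 * r)
      have h3 := Finset.card_union_le (slab y₀ (2 * r) μ r) (slab y₀ (2 * r) μ (2 * r))
      have e : 2 * (2 * r) + 1 = 4 * r + 1 := by ring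
      rw [e] at h1 h2
      have : Sl.card ≤ 4 * (4 * r + 1) ^ (P.d - 1) := by rw [hSl]; omega
      exact_mod_cast this
    have hsum1 : ∑ z, q1 z ≤ 8 * 9 ^ (P.d - 1) * (2 / (r : ℝ)) ^ α * A * S / r := by
      calc ∑ z, q1 z ≤ ∑ z, (if z ∈ Sl then 2 / r * (A * (2 / (r : ℝ)) ^ ((P.d : ℝ) - 1 + α)) * S else 0) :=
            sum_le_sum fun z _ => hq1pt z
        _ = Sl.card * (2 / r * (A * (2 / (r : ℝ)) ^ ((P.d : ℝ) - 1 + α)) * S) := by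
            rw [← sum_filter, Finset.filter_mem_eq_inter, univ_inter, sum_const, nsmul_eq_mul]
        _ ≤ (4 * (4 * r + 1) ^ (P.d - 1)) * (2 / r * (A * (2 / (r : ℝ)) ^ ((P.d : ℝ) - 1 + α)) * S) :=
            mul_le_mul_of_nonneg_right hcardSl hB1
        _ = 8 * ((2 / r) * (4 * r + 1)) ^ (P.d - 1) * (2 / (r : ℝ)) ^ α * A * S / r := by
            rw [rpow_pred_add h2r hd, mul_pow]; ring
        _ ≤ 8 * 9 ^ (P.d - 1) * (2 / (r : ℝ)) ^ α * A * S / r := by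
            have h9 : (2 / r) * (4 * (r : ℝ) + 1) ≤ 9 := by
              have h4 : (4 : ℝ) ≤ r := by exact_mod_cast hr
              rw [div_mul_eq_mul_div, div_le_iff₀ hr0]; linarith
            have h9' : (0 : ℝ) ≤ (2 / r) * (4 * (r : ℝ) + 1) := by positivity
            gcongr
    -- the gradient shell
    have hB2 : (0 : ℝ) ≤ 1 / r * (A * (2 / (r : ℝ)) ^ ((P.d : ℝ) + α) + A * (2 / (r : ℝ)) ^ ((P.d : ℝ) + α)) * S := by positivity
    have hq2pt : ∀ z, q2 z ≤ if z ∈ ball y₀ (2 * r + 1) then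
        1 / r * (A * (2 / (r : ℝ)) ^ ((P.d : ℝ) + α) + A * (2 / (r : ℝ)) ^ ((P.d : ℝ) + α)) * S else 0 := by
      intro z
      by_cases hne : chi y₀ r z = chi y₀ r (z.unshift μ)
      · have : q2 z = 0 := by simp only [hq2]; rw [hne, sub_self, abs_zero, zero_mul, zero_mul]
        rw [this]; split_ifs <;> [exact hB2; exact le_rfl]
      · have hne' : chi y₀ r ((z.unshift μ).shift μ) ≠ chi y₀ r (z.unshift μ) := by rw [hzs]; exact hne
        have h1 := le_supDist_of_chi_shift_ne hr1 hN hne'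
        have h2 := supDist_le_of_chi_shift_ne hr1 hne'
        have h3 := supDist_unshift_le_succ y₀ z μ
        have h4 : supDist y₀ z ≤ supDist y₀ (z.unshift μ) + 1 := by
          have := supDist_shift_le_succ y₀ (z.unshift μ) μ; rwa [hzs] at this
        have hzb : z ∈ ball y₀ (2 * r + 1) := by rw [mem_ball]; omega
        rw [if_pos hzb]
        have hT1 : (r : ℝ) / 2 ≤ ((min (supDist y₀ z) (supDist y₁ z) : ℕ) : ℝ) := half_le_minDist hρ (by omega)
        have hT2 : (r : ℝ) / 2 ≤ ((min (supDist y₀ (z.unshift μ)) (supDist y₁ (z.unshift μ)) : ℕ) : ℝ) :=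
          half_le_minDist hρ (by omega)
        have hKa : ‖K (z.shift μ) - K z‖ ≤ A * (2 / (r : ℝ)) ^ ((P.d : ℝ) + α) := (hK2 z μ).trans (env_far_rpow hr0 hT1 hexp2 hA)
        have hKb : ‖K ((z.unshift μ).shift μ) - K (z.unshift μ)‖ ≤ A * (2 / (r : ℝ)) ^ ((P.d : ℝ) + α) :=
          (hK2 _ μ).trans (env_far_rpow hr0 hT2 hexp2 hA)
        have hdχ : |chi y₀ r z - chi y₀ r (z.unshift μ)| ≤ 1 / r := by
          have := abs_chi_shift_sub_le hr1 hN y₀ (z.unshift μ) μ; rwa [hzs] at this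
        have hψz := hψS z (by omega)
        simp only [hq2]
        gcongr
    have hcardB : ((ball y₀ (2 * r + 1)).card : ℝ) ≤ (4 * r + 3) ^ P.d := by
      have := card_ball_le y₀ (2 * r + 1)
      have e : 2 * (2 * r + 1) + 1 = 4 * r + 3 := by ring
      rw [e] at this; exact_mod_cast this
    have hsum2 : ∑ z, q2 z ≤ 2 * 10 ^ P.d * (2 / (r : ℝ)) ^ α * A * S / r := by
      calc ∑ z, q2 z ≤ ∑ z, (if z ∈ ball y₀ (2 * r + 1) then
            1 / r * (A * (2 / (r : ℝ)) ^ ((P.d : ℝ) + α) + A * (2 / (r : ℝ)) ^ ((P.d : ℝ) + α)) * S else 0) :=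
            sum_le_sum fun z _ => hq2pt z
        _ = (ball y₀ (2 * r + 1)).card * (1 / r * (A * (2 / (r : ℝ)) ^ ((P.d : ℝ) + α) + A * (2 / (r : ℝ)) ^ ((P.d : ℝ) + α)) * S) := by
            rw [← sum_filter, Finset.filter_mem_eq_inter, univ_inter, sum_const, nsmul_eq_mul]
        _ ≤ (4 * r + 3) ^ P.d * (1 / r * (A * (2 / (r : ℝ)) ^ ((P.d : ℝ) + α) + A * (2 / (r : ℝ)) ^ ((P.d : ℝ) + α)) * S) :=
            mul_le_mul_of_nonneg_right hcardB hB2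
        _ = 2 * ((2 / r) * (4 * r + 3)) ^ P.d * (2 / (r : ℝ)) ^ α * A * S / r := by rw [rpow_nat_add h2r, mul_pow]; ring
        _ ≤ 2 * 10 ^ P.d * (2 / (r : ℝ)) ^ α * A * S / r := by
            have h10 : (2 / r) * (4 * (r : ℝ) + 3) ≤ 10 := by
              have h4 : (4 : ℝ) ≤ r := by exact_mod_cast hr
              rw [div_mul_eq_mul_div, div_le_iff₀ hr0]; linarith
            have h10' : (0 : ℝ) ≤ (2 / r) * (4 * (r : ℝ) + 3) := by positivity
            gcongr
    calc _ ≤ ∑ z, (q1 z + q2 z) := sum_le_sum fun z _ => hpt z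
      _ = ∑ z, q1 z + ∑ z, q2 z := sum_add_distrib
      _ ≤ 8 * 9 ^ (P.d - 1) * (2 / (r : ℝ)) ^ α * A * S / r + 2 * 10 ^ P.d * (2 / (r : ℝ)) ^ α * A * S / r := add_le_add hsum1 hsum2
      _ = A * S * (8 * 9 ^ (P.d - 1) + 2 * 10 ^ P.d) * (2 / (r : ℝ)) ^ α / r := by ring
  -- sum over the directions
  calc _ ≤ ∑ z : Balaban1983to89.Site P 0, ‖(∑ μ : Fin P.d,
        ((((chi y₀ r (z.shift μ) : ℝ) : ℂ) - ((chi y₀ r z : ℝ) : ℂ)) * K (z.shift μ) +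
          (((chi y₀ r (z.unshift μ) : ℝ) : ℂ) - ((chi y₀ r z : ℝ) : ℂ)) * K (z.unshift μ)))‖ * ‖ψ z‖ :=
        (norm_sum_le _ _).trans (sum_le_sum fun z _ => (norm_mul_le _ _))
    _ ≤ ∑ z : Balaban1983to89.Site P 0, ∑ μ : Fin P.d, ‖((((chi y₀ r (z.shift μ) : ℝ) : ℂ) - ((chi y₀ r z : ℝ) : ℂ)) * K (z.shift μ) +
          (((chi y₀ r (z.unshift μ) : ℝ) : ℂ) - ((chi y₀ r z : ℝ) : ℂ)) * K (z.unshift μ))‖ * ‖ψ z‖ := by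
        refine sum_le_sum fun z _ => ?_
        rw [← sum_mul]
        exact mul_le_mul_of_nonneg_right (norm_sum_le _ _) (norm_nonneg _)
    _ = ∑ μ : Fin P.d, ∑ z : Balaban1983to89.Site P 0, ‖((((chi y₀ r (z.shift μ) : ℝ) : ℂ) - ((chi y₀ r z : ℝ) : ℂ)) * K (z.shift μ) +
          (((chi y₀ r (z.unshift μ) : ℝ) : ℂ) - ((chi y₀ r z : ℝ) : ℂ)) * K (z.unshift μ))‖ * ‖ψ z‖ := sum_comm
    _ ≤ ∑ _μ : Fin P.d, A * S * (8 * 9 ^ (P.d - 1) + 2 * 10 ^ P.d) * (2 / (r : ℝ)) ^ α / r := sum_le_sum fun μ _ => hμ μ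
    _ = _ := by rw [sum_const, card_univ, Fintype.card_fin, nsmul_eq_mul]

/-- **THE BLOCK PART OF THE COMMUTATOR** with the bi-radial Hölder envelope (no cancellation used; each block average is swapped onto the
envelope, two-centre radial sums over the balls `2r + L^k` and `2r`). [cite: BalabanImbrieJaffe1985, p.326] -/
theorem commQ_le' (hd : 1 ≤ P.d) {a : ℝ} {k : ℕ} (hk : k ≤ P.m + P.K) (hα : 0 ≤ B1RG242Torus.α P a k) {r : ℕ} (hr : 1 ≤ r)
    (y₀ y₁ : Balaban1983to89.Site P 0) (K ψ : Balaban1983to89.Site P 0 → ℂ) {A S α : ℝ} (hA : 0 ≤ A) (hS : 0 ≤ S) (hα0 : 0 ≤ α)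
    (hα1 : α < 1)
    (hK1 : ∀ z, ‖K z‖ ≤ A / (max ((min (supDist y₀ z) (supDist y₁ z) : ℕ) : ℝ) 1) ^ ((P.d : ℝ) - 1 + α))
    (hψS : ∀ z, supDist y₀ z ≤ 2 * r + P.L ^ k → ‖ψ z‖ ≤ S) :
    ‖∑ z : Balaban1983to89.Site P 0, (((B1RG242Torus.α P a k * (P.L : ℝ) ^ (k * P.d) : ℝ) : ℂ) *
        (((chi y₀ r z : ℝ) : ℂ) * ((((qMatK (1 : GaugeField P 0 U1) k univ)ᴴ * qMatK (1 : GaugeField P 0 U1) k univ)) *ᵥ K) z -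
          ((((qMatK (1 : GaugeField P 0 U1) k univ)ᴴ * qMatK (1 : GaugeField P 0 U1) k univ)) *ᵥ
            fun w => ((chi y₀ r w : ℝ) : ℂ) * K w) z)) * ψ z‖ ≤
      B1RG242Torus.α P a k * S *
        ((A * (1 + 2 * P.d * 3 ^ (P.d - 1) * ((((2 * r + P.L ^ k : ℕ) : ℝ)) ^ (1 - α) / (1 - α))) +
          A * (1 + 2 * P.d * 3 ^ (P.d - 1) * ((((2 * r + P.L ^ k + supDist y₀ y₁ : ℕ) : ℝ)) ^ (1 - α) / (1 - α)))) +
        (A * (1 + 2 * P.d * 3 ^ (P.d - 1) * ((((2 * r : ℕ) : ℝ)) ^ (1 - α) / (1 - α))) +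
          A * (1 + 2 * P.d * 3 ^ (P.d - 1) * ((((2 * r + supDist y₀ y₁ : ℕ) : ℝ)) ^ (1 - α) / (1 - α))))) := by
  classical
  set a' : ℝ := B1RG242Torus.α P a k * (P.L : ℝ) ^ (k * P.d) with ha'def
  set QQ := B1RG242Torus.Qks P k * B1RG242Torus.Qk P k with hQQ
  set Q1 := (qMatK (1 : GaugeField P 0 U1) k univ)ᴴ * qMatK (1 : GaugeField P 0 U1) k univ with hQ1
  have ha' : 0 ≤ a' := mul_nonneg hα (pow_nonneg P.cast_L_pos.le _)
  set nK : Balaban1983to89.Site P 0 → ℝ := fun w => ‖K w‖ with hnK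
  set nKχ : Balaban1983to89.Site P 0 → ℝ := fun w => chi y₀ r w * ‖K w‖ with hnKχ
  have hQ : ∀ (g : Balaban1983to89.Site P 0 → ℂ) z, a' * ‖(Q1 *ᵥ g) z‖ ≤ B1RG242Torus.α P a k * (QQ *ᵥ fun w => ‖g w‖) z := by
    intro g z
    have h1 := norm_gram_qMatK_mulVec_le hk (1 : GaugeField P 0 U1) g z
    have hN : 0 < (P.L : ℝ) ^ (k * P.d) := pow_pos P.cast_L_pos _
    calc a' * ‖(Q1 *ᵥ g) z‖ ≤ a' * (((P.L : ℝ) ^ (k * P.d))⁻¹ * (QQ *ᵥ fun w => ‖g w‖) z) := mul_le_mul_of_nonneg_left h1 ha'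
      _ = B1RG242Torus.α P a k * (QQ *ᵥ fun w => ‖g w‖) z := by rw [ha'def]; field_simp
  have hQQnn : ∀ (v : Balaban1983to89.Site P 0 → ℝ), (∀ w, 0 ≤ v w) → ∀ z, 0 ≤ (QQ *ᵥ v) z := fun v hv z => by
    rw [hQQ, towerQQ_apply_blockK hk]; exact mul_nonneg (by positivity) (sum_nonneg fun w _ => hv w)
  -- part (i)
  have hpart1 : ∑ z, a' * (chi y₀ r z * ‖(Q1 *ᵥ K) z‖) * ‖ψ z‖ ≤
      B1RG242Torus.α P a k * S *
        (A * (1 + 2 * P.d * 3 ^ (P.d - 1) * ((((2 * r + P.L ^ k : ℕ) : ℝ)) ^ (1 - α) / (1 - α))) +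
          A * (1 + 2 * P.d * 3 ^ (P.d - 1) * ((((2 * r + P.L ^ k + supDist y₀ y₁ : ℕ) : ℝ)) ^ (1 - α) / (1 - α)))) := by
    have hpt : ∀ z, a' * (chi y₀ r z * ‖(Q1 *ᵥ K) z‖) * ‖ψ z‖ ≤
        B1RG242Torus.α P a k * S * (if z ∈ ball y₀ (2 * r) then (QQ *ᵥ nK) z else 0) := by
      intro z
      have hχ0 := chi_nonneg y₀ r z
      by_cases h0 : chi y₀ r z = 0
      · rw [h0, zero_mul, mul_zero, zero_mul]; split_ifs <;> [exact mul_nonneg (mul_nonneg hα hS) (hQQnn _ (fun w => norm_nonneg _) z); simp]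
      · have hT := supDist_lt_of_chi_ne_zero hr h0
        rw [if_pos (mem_ball.2 hT.le)]
        have hψz := hψS z (by omega)
        have hχ1 := chi_le_one hr y₀ z
        calc a' * (chi y₀ r z * ‖(Q1 *ᵥ K) z‖) * ‖ψ z‖ ≤ a' * (1 * ‖(Q1 *ᵥ K) z‖) * S := by gcongr
          _ = (a' * ‖(Q1 *ᵥ K) z‖) * S := by ring
          _ ≤ (B1RG242Torus.α P a k * (QQ *ᵥ nK) z) * S := mul_le_mul_of_nonneg_right (hQ K z) hS
          _ = _ := by ring
    refine (sum_le_sum fun z _ => hpt z).trans ?_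
    rw [← mul_sum, ← sum_filter, Finset.filter_mem_eq_inter, univ_inter]
    refine mul_le_mul_of_nonneg_left ?_ (mul_nonneg hα hS)
    refine (sum_towerQQ_le hk nK (fun w => norm_nonneg _) _).trans ?_
    refine biradial_rpow hd y₀ y₁ (2 * r + P.L ^ k) hA hα0 hα1 _ (fun w _ => ?_) (fun w hw => ?_)
    · split_ifs
      · exact hK1 w
      · positivity
    · rw [if_neg]
      rintro ⟨x, hx, hxw⟩
      rw [mem_ball] at hx
      have h1 := supDist_le_of_blkIter_eq' hk hxw
      have h2 := supDist_triangle y₀ x w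
      omega
  -- part (ii)
  have hpart2 : ∑ z, a' * ‖(Q1 *ᵥ fun w => ((chi y₀ r w : ℝ) : ℂ) * K w) z‖ * ‖ψ z‖ ≤
      B1RG242Torus.α P a k * S *
        (A * (1 + 2 * P.d * 3 ^ (P.d - 1) * ((((2 * r : ℕ) : ℝ)) ^ (1 - α) / (1 - α))) +
          A * (1 + 2 * P.d * 3 ^ (P.d - 1) * ((((2 * r + supDist y₀ y₁ : ℕ) : ℝ)) ^ (1 - α) / (1 - α)))) := by
    have hnn : ∀ w, 0 ≤ nKχ w := fun w => mul_nonneg (chi_nonneg y₀ r w) (norm_nonneg _)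
    have hnorm : (fun w => ‖((chi y₀ r w : ℝ) : ℂ) * K w‖) = nKχ := by
      funext w; rw [hnKχ, norm_mul, Complex.norm_real, Real.norm_of_nonneg (chi_nonneg y₀ r w)]
    have hpt : ∀ z, a' * ‖(Q1 *ᵥ fun w => ((chi y₀ r w : ℝ) : ℂ) * K w) z‖ * ‖ψ z‖ ≤ B1RG242Torus.α P a k * S * (QQ *ᵥ nKχ) z := by
      intro z
      have h1 := hQ (fun w => ((chi y₀ r w : ℝ) : ℂ) * K w) z
      rw [hnorm] at h1
      by_cases hz : (QQ *ᵥ nKχ) z = 0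
      · rw [hz] at h1 ⊢
        have : a' * ‖(Q1 *ᵥ fun w => ((chi y₀ r w : ℝ) : ℂ) * K w) z‖ = 0 :=
          le_antisymm (by simpa using h1) (mul_nonneg ha' (norm_nonneg _))
        rw [this, zero_mul, mul_zero]
      · have hex : ∃ w ∈ blockK k (blkIter k z), nKχ w ≠ 0 := by
          by_contra hno
          push Not at hno
          apply hz
          rw [hQQ, towerQQ_apply_blockK hk, sum_eq_zero hno, mul_zero]
        obtain ⟨w, hw, hw0⟩ := hex
        have hχw : chi y₀ r w ≠ 0 := fun h => hw0 (by rw [hnKχ]; simp [h])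
        have hTw := supDist_lt_of_chi_ne_zero hr hχw
        have hzw : supDist w z ≤ P.L ^ k := supDist_le_of_blkIter_eq' hk (mem_blockK.1 hw)
        have hTz : supDist y₀ z ≤ 2 * r + P.L ^ k := by
          have := supDist_triangle y₀ w z; omega
        have hψz := hψS z hTz
        calc a' * ‖(Q1 *ᵥ fun w => ((chi y₀ r w : ℝ) : ℂ) * K w) z‖ * ‖ψ z‖ ≤ (B1RG242Torus.α P a k * (QQ *ᵥ nKχ) z) * S :=
              mul_le_mul h1 hψz (norm_nonneg _) (mul_nonneg hα (hQQnn _ hnn z))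
          _ = _ := by ring
    refine (sum_le_sum fun z _ => hpt z).trans ?_
    rw [← mul_sum]
    refine mul_le_mul_of_nonneg_left ?_ (mul_nonneg hα hS)
    have h2 := sum_towerQQ_le hk nKχ hnn univ
    rw [show (∑ x ∈ (univ : Finset (Balaban1983to89.Site P 0)), (QQ *ᵥ nKχ) x) = ∑ x, (QQ *ᵥ nKχ) x from rfl] at h2
    refine h2.trans ?_
    refine biradial_rpow hd y₀ y₁ (2 * r) hA hα0 hα1 _ (fun w _ => ?_) (fun w hw => ?_)
    · have hχ1 := chi_le_one hr y₀ w
      have hχ0 := chi_nonneg y₀ r w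
      split_ifs
      · calc nKχ w = chi y₀ r w * ‖K w‖ := rfl
          _ ≤ 1 * (A / (max ((min (supDist y₀ w) (supDist y₁ w) : ℕ) : ℝ) 1) ^ ((P.d : ℝ) - 1 + α)) := by gcongr; exact hK1 w
          _ = _ := one_mul _
      · positivity
    · have h0 : chi y₀ r w = 0 := by
        by_contra h0; have := supDist_lt_of_chi_ne_zero hr h0; omega
      split_ifs
      · show chi y₀ r w * ‖K w‖ ≤ 0
        rw [h0, zero_mul]
      · exact le_rfl
  -- combine
  have hpt : ∀ z, ‖((a' : ℝ) : ℂ) * (((chi y₀ r z : ℝ) : ℂ) * (Q1 *ᵥ K) z - (Q1 *ᵥ fun w => ((chi y₀ r w : ℝ) : ℂ) * K w) z) * ψ z‖ ≤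
      a' * (chi y₀ r z * ‖(Q1 *ᵥ K) z‖) * ‖ψ z‖ + a' * ‖(Q1 *ᵥ fun w => ((chi y₀ r w : ℝ) : ℂ) * K w) z‖ * ‖ψ z‖ := by
    intro z
    rw [norm_mul, norm_mul, Complex.norm_real, Real.norm_of_nonneg ha']
    have h := norm_sub_le (((chi y₀ r z : ℝ) : ℂ) * (Q1 *ᵥ K) z) ((Q1 *ᵥ fun w => ((chi y₀ r w : ℝ) : ℂ) * K w) z)
    rw [norm_mul, Complex.norm_real, Real.norm_of_nonneg (chi_nonneg y₀ r z)] at h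
    calc a' * ‖((chi y₀ r z : ℝ) : ℂ) * (Q1 *ᵥ K) z - (Q1 *ᵥ fun w => ((chi y₀ r w : ℝ) : ℂ) * K w) z‖ * ‖ψ z‖
        ≤ a' * (chi y₀ r z * ‖(Q1 *ᵥ K) z‖ + ‖(Q1 *ᵥ fun w => ((chi y₀ r w : ℝ) : ℂ) * K w) z‖) * ‖ψ z‖ := by gcongr
      _ = _ := by ring
  calc _ ≤ ∑ z, (a' * (chi y₀ r z * ‖(Q1 *ᵥ K) z‖) * ‖ψ z‖ + a' * ‖(Q1 *ᵥ fun w => ((chi y₀ r w : ℝ) : ℂ) * K w) z‖ * ‖ψ z‖) :=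
        (norm_sum_le _ _).trans (sum_le_sum fun z _ => hpt z)
    _ = _ := sum_add_distrib
    _ ≤ _ := add_le_add hpart1 hpart2
    _ = _ := by ring

set_option maxHeartbeats 800000 in
/-- **THE LOCAL TWO-BOND INTERIOR ESTIMATE** (our device for the Hölder member of [7] (1.9); divergence of method from [7]'s random-walk
expansion as in gen 25).  Data: two bonds `⟨y₀, y₀+e_{μ₀}⟩`, `⟨y₁, y₁+e_{μ₀}⟩` with `2|y₀−y₁|_∞ + 4 ≤ r`; a `U(1)` field whose bond variables
deviate from `1` at most `γ·R(z)`, `R(z) = min(|z−y₀|_∞, |z−y₁|_∞)`, on the ball `|z−y₀|_∞ ≤ 2r` (the axis-rooted tree gauge of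
`BIJ85BiCentredAxialGauge` produces this with `γ = (d−1)θ` for an axis-parallel pair); a solution of `N(u)ψ = f′`; local bounds `‖ψ‖ ≤ S`
(ball `2r + L^k + 1`), `‖u_bψ(b₊) − ψ(b₋)‖ ≤ M`, `‖f′‖ ≤ F` (ball `2r`); and the Hölder envelopes of the DIFFERENCE of the two flat kernels
with constant `A` (`BIJ85FlatPropagatorKernelHolder.flat_kernel_holder`: `A = Cε²|y₀−y₁|_∞^α`).  Conclusion, `r ≥ 4`, `4r + 6 ≤ sitesPerDir`:
`‖(ψ(y₁+e) − ψ(y₁)) − (ψ(y₀+e) − ψ(y₀))‖ ≤ C(d,α)·(F A r^{1−α} + ε⁻²(γA(r·r^{1−α}M + r^{1−α}S) + A S r^{−α}/r) + α_kA(r + L^k)^{1−α}S)`.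
[cite: BalabanImbrieJaffe1985, (4.6.2) p.313; Balaban1983RegularityDecay, (1.9) p.573] -/
theorem local_holder_bound (dd : ℕ) (hdd : 1 ≤ dd) {α : ℝ} (hα0 : 0 ≤ α) (hα1 : α < 1) :
    ∃ C : ℝ, 0 < C ∧ ∀ (P : Params), P.d = dd → ∀ {a : ℝ}, 0 < a → ∀ {k : ℕ}, 1 ≤ k → k ≤ P.K →
      ∀ {r : ℕ}, 4 ≤ r → 4 * r + 6 ≤ P.sitesPerDir 0 →
      ∀ (y₀ y₁ : Balaban1983to89.Site P 0) (μ₀ : Fin P.d), 2 * supDist y₀ y₁ + 4 ≤ r →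
      ∀ (U : GaugeField P 0 U1) (ψ f' : Balaban1983to89.Site P 0 → ℂ),
        nOp (B1RG242Torus.α P a k * (P.L : ℝ) ^ (k * P.d)) P.eps⁻¹ U k univ *ᵥ ψ = f' →
      ∀ {A γ S Mloc Floc : ℝ}, 0 ≤ A → 0 ≤ γ → 0 ≤ S → 0 ≤ Mloc → 0 ≤ Floc →
        (∀ z, |((B1RG242Torus.tower P a 0).G k (y₁.shift μ₀) z - (B1RG242Torus.tower P a 0).G k y₁ z) -
            ((B1RG242Torus.tower P a 0).G k (y₀.shift μ₀) z - (B1RG242Torus.tower P a 0).G k y₀ z)| ≤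
            A / (max ((min (supDist y₀ z) (supDist y₁ z) : ℕ) : ℝ) 1) ^ ((P.d : ℝ) - 1 + α)) →
        (∀ (ν : Fin P.d) z,
          |(((B1RG242Torus.tower P a 0).G k (y₁.shift μ₀) (z.shift ν) - (B1RG242Torus.tower P a 0).G k y₁ (z.shift ν)) -
              ((B1RG242Torus.tower P a 0).G k (y₀.shift μ₀) (z.shift ν) - (B1RG242Torus.tower P a 0).G k y₀ (z.shift ν))) -
            (((B1RG242Torus.tower P a 0).G k (y₁.shift μ₀) z - (B1RG242Torus.tower P a 0).G k y₁ z) -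
              ((B1RG242Torus.tower P a 0).G k (y₀.shift μ₀) z - (B1RG242Torus.tower P a 0).G k y₀ z))| ≤
            A / (max ((min (supDist y₀ z) (supDist y₁ z) : ℕ) : ℝ) 1) ^ ((P.d : ℝ) + α)) →
        (∀ z μ, supDist y₀ z ≤ 2 * r → ‖cfg U ⟨z, μ⟩ - 1‖ ≤ γ * ((min (supDist y₀ z) (supDist y₁ z) : ℕ) : ℝ)) →
        (∀ z, supDist y₀ z ≤ 2 * r + P.L ^ k + 1 → ‖ψ z‖ ≤ S) →
        (∀ z μ, supDist y₀ z ≤ 2 * r → ‖cfg U ⟨z, μ⟩ * ψ (z.shift μ) - ψ z‖ ≤ Mloc) →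
        (∀ z, supDist y₀ z ≤ 2 * r → ‖f' z‖ ≤ Floc) →
        ‖(ψ (y₁.shift μ₀) - ψ y₁) - (ψ (y₀.shift μ₀) - ψ y₀)‖ ≤
          C * (Floc * A * (r : ℝ) ^ (1 - α) +
            P.eps⁻¹ ^ 2 * (γ * A * (r * (r : ℝ) ^ (1 - α) * Mloc + (r : ℝ) ^ (1 - α) * S) + A * S * ((r : ℝ) ^ (-α) / r)) +
            B1RG242Torus.α P a k * A * ((r : ℝ) + (P.L : ℝ) ^ k) ^ (1 - α) * S) := by
  -- the constants
  have h1α : 0 < 1 - α := by linarith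
  set s₁ : ℝ := 2 * dd * 3 ^ (dd - 1) with hs₁
  have hs₁0 : 0 ≤ s₁ := by positivity
  set KF : ℝ := 2 + 5 * s₁ / (1 - α) with hKF
  set KM : ℝ := dd * (13 * s₁) with hKM
  set Kγ : ℝ := dd * (13 * s₁ * 2 ^ dd + KF) with hKγ
  set Kr : ℝ := 2 * dd * (8 * 9 ^ (dd - 1) + 2 * 10 ^ dd) with hKr
  set Kα : ℝ := 3 * KF + (2 + 6 * s₁ / (1 - α)) with hKα
  have hKF0 : 0 ≤ KF := by rw [hKF]; positivity
  have hKM0 : 0 ≤ KM := by rw [hKM]; positivity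
  have hKγ0 : 0 ≤ Kγ := by rw [hKγ]; positivity
  have hKr0 : 0 ≤ Kr := by rw [hKr]; positivity
  have hKα0 : 0 ≤ Kα := by rw [hKα]; positivity
  refine ⟨KF + KM + Kγ + Kr + Kα + 1, by positivity, ?_⟩
  intro P hPd a ha k hk1 hkK r hr hN y₀ y₁ μ₀ hρ U ψ f' hψ A γ S Mloc Floc hA hγ hS hMloc hFloc hK1 hK2 hgauge hSψ hM hF
  subst hPd
  -- basic quantities
  have hd : 1 ≤ P.d := hdd
  have hk : k ≤ P.m + P.K := hkK.trans (Nat.le_add_left _ _)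
  have hr1 : 1 ≤ r := by omega
  have hr0 : (0 : ℝ) < r := by exact_mod_cast (show 0 < r by omega)
  have hr1' : (1 : ℝ) ≤ r := by exact_mod_cast hr1
  have hε : 0 < P.eps := P.eps_pos
  have hLpos : (0 : ℝ) < P.L := P.cast_L_pos
  have hn : (0 : ℝ) < (P.L : ℝ) ^ k := pow_pos hLpos k
  have hα : 0 < B1RG242Torus.α P a k :=
    mul_pos (B1.aSeq_pos ha (B1RG242Torus.one_lt_cast_L P) hk1) (inv_pos.2 (pow_pos (P.spacing_pos k) 2))
  set a' : ℝ := B1RG242Torus.α P a k * (P.L : ℝ) ^ (k * P.d) with ha'def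
  set Gf := gBox a' P.eps⁻¹ (1 : GaugeField P 0 U1) k univ with hGf
  set Nf := nOp a' P.eps⁻¹ (1 : GaugeField P 0 U1) k univ with hNf
  set N' := nOp a' P.eps⁻¹ U k univ with hN'
  set Q1 := (qMatK (1 : GaugeField P 0 U1) k univ)ᴴ * qMatK (1 : GaugeField P 0 U1) k univ with hQ1
  set Qu := (qMatK U k univ)ᴴ * qMatK U k univ with hQu
  set K : Balaban1983to89.Site P 0 → ℂ := fun z => (Gf (y₁.shift μ₀) z - Gf y₁ z) - (Gf (y₀.shift μ₀) z - Gf y₀ z) with hK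
  set χc : Balaban1983to89.Site P 0 → ℂ := fun z => ((chi y₀ r z : ℝ) : ℂ) with hχc
  set G := (B1RG242Torus.tower P a 0).G k with hGdef
  -- the kernel envelopes, complex form
  have hKz : ∀ z, K z = (((G (y₁.shift μ₀) z - G y₁ z) - (G (y₀.shift μ₀) z - G y₀ z) : ℝ) : ℂ) := by
    intro z
    simp only [hK, hGf, ha'def, hGdef, gBox_flat_eq_tower ha hk1 hk, map_apply, Complex.ofRealHom_eq_coe, Complex.ofReal_sub]
  have hK1' : ∀ z, ‖K z‖ ≤ A / (max ((min (supDist y₀ z) (supDist y₁ z) : ℕ) : ℝ) 1) ^ ((P.d : ℝ) - 1 + α) := fun z => by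
    rw [hKz, Complex.norm_real, Real.norm_eq_abs]; exact hK1 z
  have hK2' : ∀ z ν, ‖K (z.shift ν) - K z‖ ≤ A / (max ((min (supDist y₀ z) (supDist y₁ z) : ℕ) : ℝ) 1) ^ ((P.d : ℝ) + α) :=
    fun z ν => by
    rw [hKz, hKz, ← Complex.ofReal_sub, Complex.norm_real, Real.norm_eq_abs]; exact hK2 ν z
  -- the representation
  have hρr : supDist y₀ y₁ + 1 ≤ r := by omega
  have hχ0 : χc y₀ = 1 := by
    simp only [hχc]; rw [chi_eq_one_of_supDist_le (by rw [(supDist_eq_zero_iff y₀ y₀).2 rfl]; exact Nat.zero_le _)]; simp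
  have hχ1 : χc (y₀.shift μ₀) = 1 := by
    simp only [hχc]; rw [chi_eq_one_of_supDist_le ((supDist_shift_le_one' y₀ μ₀).trans hr1)]; simp
  have hχ2 : χc y₁ = 1 := by
    simp only [hχc]; rw [chi_eq_one_of_supDist_le (show supDist y₀ y₁ ≤ r by omega)]; simp
  have hχ3 : χc (y₁.shift μ₀) = 1 := by
    simp only [hχc]; rw [chi_eq_one_of_supDist_le ((supDist_shift_le_succ y₀ y₁ μ₀).trans hρr)]; simp
  have rep := loc_representation_pair ha hk1 hk U ψ f' hψ χc y₀ y₁ μ₀ hχ0 hχ1 hχ2 hχ3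
  have hu1 : ∀ b : PBond P 0, conj (cfg U b) * cfg U b = 1 := fun b => conj_mul_toC (U b)
  -- (T1) the source term
  have hT1 := chi_weighted_sum_le' hd hr1 y₀ y₁ K f' hA hFloc hα0 hα1 hK1' fun z hz => hF z hz.le
  -- (T2) the perturbation term
  have hW := W_sum_identity' (fun z => χc z * K z) ψ (cfg U) hu1
  simp only [hχc] at hW
  have hT2eq : ∑ z, K z * (χc z * ((N' - Nf) *ᵥ ψ) z) =
      ((P.eps⁻¹ : ℝ) : ℂ) ^ 2 * ∑ μ : Fin P.d, ∑ z : Balaban1983to89.Site P 0,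
        ((conj (cfg U ⟨z, μ⟩) - 1) * (((chi y₀ r z : ℝ) : ℂ) * K z) * (cfg U ⟨z, μ⟩ * ψ (z.shift μ) - ψ z) +
          (1 - conj (cfg U ⟨z, μ⟩)) * ((((chi y₀ r (z.shift μ) : ℝ) : ℂ) * K (z.shift μ)) - (((chi y₀ r z : ℝ) : ℂ) * K z)) * ψ z) +
      ∑ z, K z * (((chi y₀ r z : ℝ) : ℂ) * (((a' : ℝ) : ℂ) * ((Qu *ᵥ ψ) z - (Q1 *ᵥ ψ) z))) := by
    rw [← hW, mul_sum, ← sum_add_distrib]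
    refine sum_congr rfl fun z _ => ?_
    rw [hN', hNf, nOp_sub_flat_mulVec_apply, hχc]
    ring
  have hT2W := W_term_le' hd hr1 hN y₀ y₁ K ψ (cfg U) hA hγ hS hMloc hα0 hα1 hK1' hK2' hgauge (fun z hz => hSψ z (by omega)) hM
  have hT2Q : ‖∑ z, K z * (((chi y₀ r z : ℝ) : ℂ) * (((a' : ℝ) : ℂ) * ((Qu *ᵥ ψ) z - (Q1 *ᵥ ψ) z)))‖ ≤
      (2 * (B1RG242Torus.α P a k * S)) *
        (A * (1 + 2 * P.d * 3 ^ (P.d - 1) * (((2 * r : ℕ) : ℝ) ^ (1 - α) / (1 - α))) +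
          A * (1 + 2 * P.d * 3 ^ (P.d - 1) * ((((2 * r + supDist y₀ y₁ : ℕ) : ℝ)) ^ (1 - α) / (1 - α)))) := by
    refine chi_weighted_sum_le' hd hr1 y₀ y₁ K _ hA (by positivity) hα0 hα1 hK1' fun z hz => ?_
    have hblk : ∀ z', blkIter k z' = blkIter k z → ‖ψ z'‖ ≤ S := fun z' hz' => by
      refine hSψ z' ?_
      have h1 := supDist_le_of_blkIter_eq' hk hz'
      have h2 := supDist_triangle y₀ z z'
      rw [supDist_comm z z'] at h2
      omega
    have h1 := aQQ_norm_le hk hα.le U ψ z hblk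
    have h2 := aQQ_norm_le hk hα.le (1 : GaugeField P 0 U1) ψ z hblk
    have ha'0 : 0 ≤ a' := by positivity
    rw [norm_mul, Complex.norm_real, Real.norm_of_nonneg ha'0]
    calc a' * ‖(Qu *ᵥ ψ) z - (Q1 *ᵥ ψ) z‖ ≤ a' * (‖(Qu *ᵥ ψ) z‖ + ‖(Q1 *ᵥ ψ) z‖) :=
          mul_le_mul_of_nonneg_left (norm_sub_le _ _) ha'0
      _ ≤ 2 * (B1RG242Torus.α P a k * S) := by rw [mul_add]; linarith [h1, h2]
  -- (T3) the commutator term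
  have hT3eq : ∑ z, ((diagonal χc * Nf - Nf * diagonal χc) *ᵥ K) z * ψ z =
      ((P.eps⁻¹ : ℝ) : ℂ) ^ 2 * ∑ z : Balaban1983to89.Site P 0, (∑ μ : Fin P.d,
        ((((chi y₀ r (z.shift μ) : ℝ) : ℂ) - ((chi y₀ r z : ℝ) : ℂ)) * K (z.shift μ) +
          (((chi y₀ r (z.unshift μ) : ℝ) : ℂ) - ((chi y₀ r z : ℝ) : ℂ)) * K (z.unshift μ))) * ψ z +
      ∑ z : Balaban1983to89.Site P 0, (((a' : ℝ) : ℂ) *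
        (((chi y₀ r z : ℝ) : ℂ) * (Q1 *ᵥ K) z - (Q1 *ᵥ fun w => ((chi y₀ r w : ℝ) : ℂ) * K w) z)) * ψ z := by
    rw [mul_sum, ← sum_add_distrib]
    refine sum_congr rfl fun z _ => ?_
    rw [hNf, commutator_flat_apply, hχc]
    ring
  have hT3L := commLap_le' hd hr hN y₀ y₁ hρ K ψ hA hS hα0 hK1' hK2' (fun z hz => hSψ z (by omega))
  have hT3Q := commQ_le' hd hk hα.le hr1 y₀ y₁ K ψ hA hS hα0 hα1 hK1' (fun z hz => hSψ z (by omega))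
  ----------------------------------------------------------------------------------------------------------------
  -- the powers of `r`
  set Pw : ℝ := (r : ℝ) ^ (1 - α) with hPw
  set Qw : ℝ := ((r : ℝ) + (P.L : ℝ) ^ k) ^ (1 - α) with hQw
  have hPw0 : 0 ≤ Pw := Real.rpow_nonneg hr0.le _
  have hQw0 : 0 ≤ Qw := Real.rpow_nonneg (by positivity) _
  have f1 : 1 ≤ Pw := Real.one_le_rpow hr1' h1α.le
  have f6 : 1 ≤ Qw := Real.one_le_rpow (by linarith [hn.le]) h1α.le
  have f7 : Pw ≤ Qw := Real.rpow_le_rpow hr0.le (by linarith [hn.le]) h1α.le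
  have hρle : (supDist y₀ y₁ : ℝ) ≤ r := by exact_mod_cast (show supDist y₀ y₁ ≤ r by omega)
  have f2 : (((2 * r : ℕ) : ℝ)) ^ (1 - α) ≤ 2 * Pw :=
    rpow_le_mul_rpow (by norm_num) (by positivity) hr0.le (by push_cast; linarith) h1α.le (by linarith)
  have f3 : (((2 * r + supDist y₀ y₁ : ℕ) : ℝ)) ^ (1 - α) ≤ 3 * Pw :=
    rpow_le_mul_rpow (by norm_num) (by positivity) hr0.le (by push_cast; linarith) h1α.le (by linarith)
  have f4 : (((2 * r + P.L ^ k : ℕ) : ℝ)) ^ (1 - α) ≤ 3 * Qw :=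
    rpow_le_mul_rpow (by norm_num) (by positivity) (by positivity) (by push_cast; linarith [hn.le]) h1α.le (by linarith)
  have f5 : (((2 * r + P.L ^ k + supDist y₀ y₁ : ℕ) : ℝ)) ^ (1 - α) ≤ 3 * Qw :=
    rpow_le_mul_rpow (by norm_num) (by positivity) (by positivity) (by push_cast; linarith [hn.le]) h1α.le (by linarith)
  have f8 : (2 / (r : ℝ)) ^ α ≤ 2 * (r : ℝ) ^ (-α) := two_div_rpow_le hr0 hα1.le
  have f9 : (2 : ℝ) ^ ((P.d : ℝ) - 1 + α) ≤ 2 ^ P.d := by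
    calc (2 : ℝ) ^ ((P.d : ℝ) - 1 + α) ≤ (2 : ℝ) ^ ((P.d : ℝ)) := Real.rpow_le_rpow_of_exponent_le one_le_two (by linarith)
      _ = 2 ^ P.d := Real.rpow_natCast 2 P.d
  have hs₁P : 2 * (P.d : ℝ) * 3 ^ (P.d - 1) = s₁ := by rw [hs₁]
  -- the two-centre radial factors
  have hBR1 : A * (1 + 2 * P.d * 3 ^ (P.d - 1) * (((2 * r : ℕ) : ℝ) ^ (1 - α) / (1 - α))) +
      A * (1 + 2 * P.d * 3 ^ (P.d - 1) * ((((2 * r + supDist y₀ y₁ : ℕ) : ℝ)) ^ (1 - α) / (1 - α))) ≤ KF * (A * Pw) := by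
    rw [hs₁P]
    have h1 : A * (1 + s₁ * (((2 * r : ℕ) : ℝ) ^ (1 - α) / (1 - α))) ≤ A * (1 + s₁ * ((2 * Pw) / (1 - α))) := by gcongr
    have h2 : A * (1 + s₁ * ((((2 * r + supDist y₀ y₁ : ℕ) : ℝ)) ^ (1 - α) / (1 - α))) ≤ A * (1 + s₁ * ((3 * Pw) / (1 - α))) := by
      gcongr
    have h3 : A * 2 ≤ A * 2 * Pw := le_mul_of_one_le_right (by positivity) f1
    calc _ ≤ A * (1 + s₁ * ((2 * Pw) / (1 - α))) + A * (1 + s₁ * ((3 * Pw) / (1 - α))) := add_le_add h1 h2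
      _ = A * 2 + 5 * s₁ / (1 - α) * (A * Pw) := by field_simp; ring
      _ ≤ A * 2 * Pw + 5 * s₁ / (1 - α) * (A * Pw) := by linarith
      _ = KF * (A * Pw) := by rw [hKF]; ring
  have hBR1' : A * (1 + 2 * P.d * 3 ^ (P.d - 1) * ((((2 * r + P.L ^ k : ℕ) : ℝ)) ^ (1 - α) / (1 - α))) +
      A * (1 + 2 * P.d * 3 ^ (P.d - 1) * ((((2 * r + P.L ^ k + supDist y₀ y₁ : ℕ) : ℝ)) ^ (1 - α) / (1 - α))) ≤
      (2 + 6 * s₁ / (1 - α)) * (A * Qw) := by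
    rw [hs₁P]
    have h1 : A * (1 + s₁ * ((((2 * r + P.L ^ k : ℕ) : ℝ)) ^ (1 - α) / (1 - α))) ≤ A * (1 + s₁ * ((3 * Qw) / (1 - α))) := by gcongr
    have h2 : A * (1 + s₁ * ((((2 * r + P.L ^ k + supDist y₀ y₁ : ℕ) : ℝ)) ^ (1 - α) / (1 - α))) ≤
        A * (1 + s₁ * ((3 * Qw) / (1 - α))) := by gcongr
    have h3 : A * 2 ≤ A * 2 * Qw := le_mul_of_one_le_right (by positivity) f6
    calc _ ≤ A * (1 + s₁ * ((3 * Qw) / (1 - α))) + A * (1 + s₁ * ((3 * Qw) / (1 - α))) := add_le_add h1 h2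
      _ = A * 2 + 6 * s₁ / (1 - α) * (A * Qw) := by field_simp; ring
      _ ≤ A * 2 * Qw + 6 * s₁ / (1 - α) * (A * Qw) := by linarith
      _ = (2 + 6 * s₁ / (1 - α)) * (A * Qw) := by ring
  have hBR2 : ((2 * r : ℕ) : ℝ) * ((2 * r : ℕ) : ℝ) ^ (1 - α) +
      ((2 * r + supDist y₀ y₁ : ℕ) : ℝ) * (((2 * r + supDist y₀ y₁ : ℕ) : ℝ)) ^ (1 - α) ≤ 13 * (r * Pw) := by
    have h1 : ((2 * r : ℕ) : ℝ) * ((2 * r : ℕ) : ℝ) ^ (1 - α) ≤ (2 * r) * (2 * Pw) :=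
      mul_le_mul (by push_cast; exact le_rfl) f2 (by positivity) (by positivity)
    have h2 : ((2 * r + supDist y₀ y₁ : ℕ) : ℝ) * (((2 * r + supDist y₀ y₁ : ℕ) : ℝ)) ^ (1 - α) ≤ (3 * r) * (3 * Pw) :=
      mul_le_mul (by push_cast; linarith) f3 (by positivity) (by positivity)
    linarith
  ----------------------------------------------------------------------------------------------------------------
  -- block bounds
  have b1 : ‖∑ z, K z * (χc z * f' z)‖ ≤ KF * (Floc * A * Pw) := by
    refine hT1.trans ?_
    calc Floc * _ ≤ Floc * (KF * (A * Pw)) := mul_le_mul_of_nonneg_left hBR1 hFloc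
      _ = KF * (Floc * A * Pw) := by ring
  have b2Q : ‖∑ z, K z * (((chi y₀ r z : ℝ) : ℂ) * (((a' : ℝ) : ℂ) * ((Qu *ᵥ ψ) z - (Q1 *ᵥ ψ) z)))‖ ≤
      (2 * KF) * (B1RG242Torus.α P a k * A * Qw * S) := by
    refine hT2Q.trans ?_
    calc 2 * (B1RG242Torus.α P a k * S) * _ ≤ 2 * (B1RG242Torus.α P a k * S) * (KF * (A * Pw)) :=
          mul_le_mul_of_nonneg_left hBR1 (by positivity)
      _ ≤ 2 * (B1RG242Torus.α P a k * S) * (KF * (A * Qw)) := by gcongr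
      _ = (2 * KF) * (B1RG242Torus.α P a k * A * Qw * S) := by ring
  have b2W : (P.d : ℝ) * (2 * P.d * 3 ^ (P.d - 1) * (γ * (A * (Mloc + 2 ^ ((P.d : ℝ) - 1 + α) * S / r))) *
          ((2 * r : ℕ) * ((2 * r : ℕ) : ℝ) ^ (1 - α)) +
        2 * P.d * 3 ^ (P.d - 1) * (γ * (A * (Mloc + 2 ^ ((P.d : ℝ) - 1 + α) * S / r))) *
          (((2 * r + supDist y₀ y₁ : ℕ) : ℝ) * (((2 * r + supDist y₀ y₁ : ℕ) : ℝ)) ^ (1 - α)) +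
        (γ * (A * S) * (1 + 2 * P.d * 3 ^ (P.d - 1) * (((2 * r : ℕ) : ℝ) ^ (1 - α) / (1 - α))) +
          γ * (A * S) * (1 + 2 * P.d * 3 ^ (P.d - 1) * ((((2 * r + supDist y₀ y₁ : ℕ) : ℝ)) ^ (1 - α) / (1 - α))))) ≤
      KM * (γ * A * (r * Pw * Mloc)) + Kγ * (γ * A * (Pw * S)) := by
    rw [hs₁P]
    -- the `M + 2^{p₁}S/r` part
    have hw : 0 ≤ s₁ * (γ * (A * (Mloc + 2 ^ ((P.d : ℝ) - 1 + α) * S / r))) := by positivity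
    have q1 : s₁ * (γ * (A * (Mloc + 2 ^ ((P.d : ℝ) - 1 + α) * S / r))) * ((2 * r : ℕ) * ((2 * r : ℕ) : ℝ) ^ (1 - α)) +
        s₁ * (γ * (A * (Mloc + 2 ^ ((P.d : ℝ) - 1 + α) * S / r))) *
          (((2 * r + supDist y₀ y₁ : ℕ) : ℝ) * (((2 * r + supDist y₀ y₁ : ℕ) : ℝ)) ^ (1 - α)) ≤
        s₁ * (γ * (A * (Mloc + 2 ^ ((P.d : ℝ) - 1 + α) * S / r))) * (13 * (r * Pw)) := by
      rw [← mul_add]; exact mul_le_mul_of_nonneg_left hBR2 hw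
    have q2 : s₁ * (γ * (A * (Mloc + 2 ^ ((P.d : ℝ) - 1 + α) * S / r))) * (13 * (r * Pw)) =
        13 * s₁ * (γ * A * (r * Pw * Mloc)) + 13 * s₁ * 2 ^ ((P.d : ℝ) - 1 + α) * (γ * A * (Pw * S)) := by
      field_simp
    have q3 : 13 * s₁ * 2 ^ ((P.d : ℝ) - 1 + α) * (γ * A * (Pw * S)) ≤ 13 * s₁ * 2 ^ P.d * (γ * A * (Pw * S)) := by
      have : 0 ≤ γ * A * (Pw * S) := by positivity
      have : 0 ≤ 13 * s₁ := by positivity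
      gcongr
    -- the `S` part
    have q4 : γ * (A * S) * (1 + s₁ * (((2 * r : ℕ) : ℝ) ^ (1 - α) / (1 - α))) +
        γ * (A * S) * (1 + s₁ * ((((2 * r + supDist y₀ y₁ : ℕ) : ℝ)) ^ (1 - α) / (1 - α))) ≤ KF * (γ * A * (Pw * S)) := by
      have e : γ * (A * S) * (1 + s₁ * (((2 * r : ℕ) : ℝ) ^ (1 - α) / (1 - α))) +
          γ * (A * S) * (1 + s₁ * ((((2 * r + supDist y₀ y₁ : ℕ) : ℝ)) ^ (1 - α) / (1 - α))) =
          γ * S * (A * (1 + s₁ * (((2 * r : ℕ) : ℝ) ^ (1 - α) / (1 - α))) +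
            A * (1 + s₁ * ((((2 * r + supDist y₀ y₁ : ℕ) : ℝ)) ^ (1 - α) / (1 - α)))) := by ring
      rw [e]
      have hBR1s : A * (1 + s₁ * (((2 * r : ℕ) : ℝ) ^ (1 - α) / (1 - α))) +
          A * (1 + s₁ * ((((2 * r + supDist y₀ y₁ : ℕ) : ℝ)) ^ (1 - α) / (1 - α))) ≤ KF * (A * Pw) := by
        have := hBR1; rw [hs₁P] at this; exact this
      calc γ * S * _ ≤ γ * S * (KF * (A * Pw)) := mul_le_mul_of_nonneg_left hBR1s (by positivity)
        _ = KF * (γ * A * (Pw * S)) := by ring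
    have hdpos : (0 : ℝ) ≤ P.d := by positivity
    calc (P.d : ℝ) * (s₁ * (γ * (A * (Mloc + 2 ^ ((P.d : ℝ) - 1 + α) * S / r))) * ((2 * r : ℕ) * ((2 * r : ℕ) : ℝ) ^ (1 - α)) +
          s₁ * (γ * (A * (Mloc + 2 ^ ((P.d : ℝ) - 1 + α) * S / r))) *
            (((2 * r + supDist y₀ y₁ : ℕ) : ℝ) * (((2 * r + supDist y₀ y₁ : ℕ) : ℝ)) ^ (1 - α)) +
          (γ * (A * S) * (1 + s₁ * (((2 * r : ℕ) : ℝ) ^ (1 - α) / (1 - α))) +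
            γ * (A * S) * (1 + s₁ * ((((2 * r + supDist y₀ y₁ : ℕ) : ℝ)) ^ (1 - α) / (1 - α)))))
        ≤ (P.d : ℝ) * (13 * s₁ * (γ * A * (r * Pw * Mloc)) + 13 * s₁ * 2 ^ P.d * (γ * A * (Pw * S)) + KF * (γ * A * (Pw * S))) := by
          refine mul_le_mul_of_nonneg_left ?_ hdpos
          linarith [q1, q2, q3, q4]
      _ = KM * (γ * A * (r * Pw * Mloc)) + Kγ * (γ * A * (Pw * S)) := by rw [hKM, hKγ]; ring
  have b3L : (P.d : ℝ) * (A * S * (8 * 9 ^ (P.d - 1) + 2 * 10 ^ P.d) * (2 / (r : ℝ)) ^ α / r) ≤ Kr * (A * S * ((r : ℝ) ^ (-α) / r)) := by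
    have h1 : (P.d : ℝ) * (A * S * (8 * 9 ^ (P.d - 1) + 2 * 10 ^ P.d) * (2 / (r : ℝ)) ^ α / r) =
        (P.d * (8 * 9 ^ (P.d - 1) + 2 * 10 ^ P.d)) * (A * S / r) * (2 / (r : ℝ)) ^ α := by ring
    rw [h1]
    calc (P.d * (8 * 9 ^ (P.d - 1) + 2 * 10 ^ P.d)) * (A * S / r) * (2 / (r : ℝ)) ^ α
        ≤ (P.d * (8 * 9 ^ (P.d - 1) + 2 * 10 ^ P.d)) * (A * S / r) * (2 * (r : ℝ) ^ (-α)) :=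
          mul_le_mul_of_nonneg_left f8 (by positivity)
      _ = Kr * (A * S * ((r : ℝ) ^ (-α) / r)) := by rw [hKr]; ring
  have b3Q : B1RG242Torus.α P a k * S *
        ((A * (1 + 2 * P.d * 3 ^ (P.d - 1) * ((((2 * r + P.L ^ k : ℕ) : ℝ)) ^ (1 - α) / (1 - α))) +
          A * (1 + 2 * P.d * 3 ^ (P.d - 1) * ((((2 * r + P.L ^ k + supDist y₀ y₁ : ℕ) : ℝ)) ^ (1 - α) / (1 - α)))) +
        (A * (1 + 2 * P.d * 3 ^ (P.d - 1) * ((((2 * r : ℕ) : ℝ)) ^ (1 - α) / (1 - α))) +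
          A * (1 + 2 * P.d * 3 ^ (P.d - 1) * ((((2 * r + supDist y₀ y₁ : ℕ) : ℝ)) ^ (1 - α) / (1 - α))))) ≤
      ((2 + 6 * s₁ / (1 - α)) + KF) * (B1RG242Torus.α P a k * A * Qw * S) := by
    have h1 : KF * (A * Pw) ≤ KF * (A * Qw) := by gcongr
    calc _ ≤ B1RG242Torus.α P a k * S * ((2 + 6 * s₁ / (1 - α)) * (A * Qw) + KF * (A * Qw)) :=
          mul_le_mul_of_nonneg_left (add_le_add hBR1' (hBR1.trans h1)) (by positivity)
      _ = _ := by ring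
  ----------------------------------------------------------------------------------------------------------------
  -- assembly
  have hT2 : ‖∑ z, K z * (χc z * ((N' - Nf) *ᵥ ψ) z)‖ ≤
      P.eps⁻¹ ^ 2 * (KM * (γ * A * (r * Pw * Mloc)) + Kγ * (γ * A * (Pw * S))) + (2 * KF) * (B1RG242Torus.α P a k * A * Qw * S) := by
    rw [hT2eq]
    refine (norm_add_le _ _).trans (add_le_add ?_ b2Q)
    rw [norm_mul, norm_pow, Complex.norm_real, Real.norm_of_nonneg (inv_nonneg.2 hε.le)]
    exact mul_le_mul_of_nonneg_left (hT2W.trans b2W) (by positivity)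
  have hT3 : ‖∑ z, ((diagonal χc * Nf - Nf * diagonal χc) *ᵥ K) z * ψ z‖ ≤
      P.eps⁻¹ ^ 2 * (Kr * (A * S * ((r : ℝ) ^ (-α) / r))) + ((2 + 6 * s₁ / (1 - α)) + KF) * (B1RG242Torus.α P a k * A * Qw * S) := by
    rw [hT3eq]
    refine (norm_add_le _ _).trans (add_le_add ?_ (hT3Q.trans b3Q))
    rw [norm_mul, norm_pow, Complex.norm_real, Real.norm_of_nonneg (inv_nonneg.2 hε.le)]
    exact mul_le_mul_of_nonneg_left (hT3L.trans b3L) (by positivity)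
  have htot : ‖(ψ (y₁.shift μ₀) - ψ y₁) - (ψ (y₀.shift μ₀) - ψ y₀)‖ ≤
      KF * (Floc * A * Pw) +
      (P.eps⁻¹ ^ 2 * (KM * (γ * A * (r * Pw * Mloc)) + Kγ * (γ * A * (Pw * S))) + (2 * KF) * (B1RG242Torus.α P a k * A * Qw * S)) +
      (P.eps⁻¹ ^ 2 * (Kr * (A * S * ((r : ℝ) ^ (-α) / r))) + ((2 + 6 * s₁ / (1 - α)) + KF) * (B1RG242Torus.α P a k * A * Qw * S)) := by
    rw [rep]
    exact (norm_add_le _ _).trans (add_le_add ((norm_sub_le _ _).trans (add_le_add b1 hT2)) hT3)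
  -- compare with the common constant
  set C := KF + KM + Kγ + Kr + Kα + 1 with hC
  have hCexp : C = KF + KM + Kγ + Kr + Kα + 1 := rfl
  have icF : KF ≤ C := by rw [hCexp]; linarith
  have icM : KM ≤ C := by rw [hCexp]; linarith
  have icγ : Kγ ≤ C := by rw [hCexp]; linarith
  have icr : Kr ≤ C := by rw [hCexp]; linarith
  have icα : Kα ≤ C := by rw [hCexp]; linarith
  have hKαe : 2 * KF + ((2 + 6 * s₁ / (1 - α)) + KF) = Kα := by rw [hKα]; ring
  have tF : 0 ≤ Floc * A * Pw := by positivity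
  have tM : 0 ≤ γ * A * (r * Pw * Mloc) := by positivity
  have tγ : 0 ≤ γ * A * (Pw * S) := by positivity
  have tr : 0 ≤ A * S * ((r : ℝ) ^ (-α) / r) := by positivity
  have tα : 0 ≤ B1RG242Torus.α P a k * A * Qw * S := by positivity
  have hε2 : 0 ≤ P.eps⁻¹ ^ 2 := by positivity
  calc ‖(ψ (y₁.shift μ₀) - ψ y₁) - (ψ (y₀.shift μ₀) - ψ y₀)‖ ≤ _ := htot
    _ = KF * (Floc * A * Pw) + P.eps⁻¹ ^ 2 * (KM * (γ * A * (r * Pw * Mloc)) + Kγ * (γ * A * (Pw * S)) + Kr * (A * S * ((r : ℝ) ^ (-α) / r))) +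
        Kα * (B1RG242Torus.α P a k * A * Qw * S) := by rw [← hKαe]; ring
    _ ≤ C * (Floc * A * Pw) + P.eps⁻¹ ^ 2 * (C * (γ * A * (r * Pw * Mloc)) + C * (γ * A * (Pw * S)) + C * (A * S * ((r : ℝ) ^ (-α) / r))) +
        C * (B1RG242Torus.α P a k * A * Qw * S) := by
        have i1 : KF * (Floc * A * Pw) ≤ C * (Floc * A * Pw) := mul_le_mul_of_nonneg_right icF tF
        have i5 : Kα * (B1RG242Torus.α P a k * A * Qw * S) ≤ C * (B1RG242Torus.α P a k * A * Qw * S) :=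
          mul_le_mul_of_nonneg_right icα tα
        have i234 : KM * (γ * A * (r * Pw * Mloc)) + Kγ * (γ * A * (Pw * S)) + Kr * (A * S * ((r : ℝ) ^ (-α) / r)) ≤
            C * (γ * A * (r * Pw * Mloc)) + C * (γ * A * (Pw * S)) + C * (A * S * ((r : ℝ) ^ (-α) / r)) := by
          have i2 : KM * (γ * A * (r * Pw * Mloc)) ≤ C * (γ * A * (r * Pw * Mloc)) := mul_le_mul_of_nonneg_right icM tM
          have i3 : Kγ * (γ * A * (Pw * S)) ≤ C * (γ * A * (Pw * S)) := mul_le_mul_of_nonneg_right icγ tγ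
          have i4 : Kr * (A * S * ((r : ℝ) ^ (-α) / r)) ≤ C * (A * S * ((r : ℝ) ^ (-α) / r)) := mul_le_mul_of_nonneg_right icr tr
          linarith only [i2, i3, i4]
        have i234' := mul_le_mul_of_nonneg_left i234 hε2
        linarith only [i1, i5, i234']
    _ = C * (Floc * A * Pw + P.eps⁻¹ ^ 2 * (γ * A * (r * Pw * Mloc + Pw * S) + A * S * ((r : ℝ) ^ (-α) / r)) +
          B1RG242Torus.α P a k * A * Qw * S) := by ring

end Local

/-! ## §4 p. 326: the HÖLDER member of [7] (1.9) at an axis-parallel pair, in the axis-rooted tree gauge, `k`-uniform -/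

section Leg

variable {P : Params}

open BIJ85BiCentredAxialGauge (centredGaugeDir dist1_centredGaugeDir_le dist1_centredGaugeDir_le_min)

/-- kernel: `(ρ/n)^α·n = ρ^α·n^{1−α}` (`ρ ≥ 0`, `n > 0`). [cite: Balaban1983RegularityDecay, (1.9) p.573] -/
theorem div_rpow_mul_eq {ρ n α : ℝ} (hρ : 0 ≤ ρ) (hn : 0 < n) : (ρ / n) ^ α * n = ρ ^ α * n ^ (1 - α) := by
  rw [Real.div_rpow hρ hn.le, Real.rpow_sub hn, Real.rpow_one]
  field_simp

/-- kernel: `r^{−α} ≤ 16·n^{−α}` when `n ≤ 16r` (`r > 0`, `0 ≤ α ≤ 1`). [cite: Balaban1983RegularityDecay, (1.9) p.573] -/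
theorem rpow_neg_le_of_le_mul {r n α : ℝ} (hr : 0 < r) (hn : 0 < n) (h : n ≤ 16 * r) (hα0 : 0 ≤ α) (hα1 : α ≤ 1) :
    r ^ (-α) ≤ 16 * n ^ (-α) := by
  rw [Real.rpow_neg hr.le, Real.rpow_neg hn.le]
  have h1 : n ^ α ≤ 16 * r ^ α := rpow_le_mul_rpow (by norm_num) hn.le hr.le h hα0 hα1
  have h2 : 0 < n ^ α := Real.rpow_pos_of_pos hn α
  have h3 : 0 < r ^ α := Real.rpow_pos_of_pos hr α
  rw [inv_le_comm₀ h3 (by positivity), mul_inv, inv_inv]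
  calc 16⁻¹ * n ^ α ≤ 16⁻¹ * (16 * r ^ α) := mul_le_mul_of_nonneg_left h1 (by norm_num)
    _ = r ^ α := by ring

set_option maxHeartbeats 800000 in
/-- **p. 326: THE HÖLDER MEMBER OF [7] (1.9) FOR THE COVARIANT DERIVATIVE OF THE BLOCK PROPAGATOR `G_k(u)` AT SMALL NON-FLAT FIELDS,
AXIS-PARALLEL PAIRS, IN THE AXIS-ROOTED GAUGE, `k`-UNIFORM** — for [BalabanImbrieJaffe1985] p. 326 *"The propagators arising from
Δ_k(u_k), under the restriction (7.3.1) on the gauge field, also satisfy the regularity and decay estimates of [7]"* and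
[Balaban1983RegularityDecay] (1.9) *"|x−x′|^{−α}|U(A(Γ_{x,x′}))(D^η_{A,μ}G_k(Ω,A)f)(x′) − (D^η_{A,μ}G_k(Ω,A)f)(x)| ≤ c₀e^{−δ₀dist({x,x′},supp f)}‖f‖_∞"*,
for p31's torus propagator of record `G_k(T,u) = gBox (α_kL^{kd}) ε⁻¹ u k T` under the hypotheses of the value member
(`BIJ85ScalarPropagatorSupDecay.decay110_smallField`): for `2 ≤ d ≤ 3`, `L` odd `> 1`, `a > 0`, `0 ≤ α < 1` there are `t₀, c₀ > 0` (on
`d, L, a, α`) such that for every volume, every `1 ≤ k ≤ K`, every `U(1)` field with `|u(∂p) − 1| ≤ θ`, `2d³(L^{2k}θ)² ≤ 1`, every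
AXIS-PARALLEL pair `x₀`, `x₁` (`x₁,ν = x₀,ν` for `ν ≠ i`) with `1 ≤ |x₀−x₁|_∞`, `64|x₀−x₁|_∞ ≤ L^k`, every direction `μ` and every `f` with
`|f| ≤ F` vanishing at sup-distance `< D` from `x₀`, there is a gauge transformation `h` (the tree gauge of the ball of radius `2⌊L^k/8⌋` rooted
along the axis `i`, `BIJ85BiCentredAxialGauge.centredGaugeDir`) in which EVERY bond based on the axis segment is trivial
(`u^h_{z,μ′} = 1` for `z` on the axis through `x₀` with `|z−x₀|_∞ ≤ |x₀−x₁|_∞` — so the transport `U(Γ_{x₀,x₁})` along the axis is `1` and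
the covariant derivatives at the two bonds are plain differences) and, for `ψ = h·G_k(T,u)f`,
`‖(ψ(x₁+e_μ) − ψ(x₁)) − (ψ(x₀+e_μ) − ψ(x₀))‖ ≤ c₀(|x₀−x₁|_∞/L^k)^α(L^kε)·ε·e^{−t₀D/L^k}F` — i.e. (1.9) with ONE power of the block spacing
(the gauge-invariant restatement with the explicit transport, general and far pairs: file 2c).  Method: §3 at `r = ⌊L^k/8⌋` in the
axis-rooted gauge (`γ = (d−1)θ`, `γL^{2k} ≤ 1`), fed with p27's value bound, gen 25's covariant-derivative bound and the Hölder envelopes of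
`BIJ85FlatPropagatorKernelHolder` (`A = C_Hε²ρ^α`).
[cite: BalabanImbrieJaffe1985, (7.3.1) p.326; Balaban1983RegularityDecay, (1.9) p.573] -/
theorem holder19_leg_gauged (d L : ℕ) (hd : 2 ≤ d) (hd3 : d ≤ 3) (hL : Odd L ∧ 1 < L) {a : ℝ} (ha : 0 < a) {α : ℝ} (hα0 : 0 ≤ α)
    (hα1 : α < 1) :
    ∃ t₀ c₀ : ℝ, 0 < t₀ ∧ 0 < c₀ ∧ ∀ (P : Params), P.d = d → P.L = L →
      ∀ k : ℕ, 1 ≤ k → k ≤ P.K → ∀ (U : GaugeField P 0 U1) (θ : ℝ),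
        (∀ (y : Balaban1983to89.Site P 0) (μ ν : Fin P.d), ‖BIJ85AbelianStokes.plaqC U y μ ν - 1‖ ≤ θ) →
        2 * (P.d : ℝ) ^ 3 * (((P.L : ℝ) ^ k) ^ 2 * θ) ^ 2 ≤ 1 →
        ∀ (x₀ x₁ : Balaban1983to89.Site P 0) (i μ : Fin P.d), (∀ ν, ν ≠ i → x₁ ν = x₀ ν) →
          1 ≤ supDist x₀ x₁ → 64 * supDist x₀ x₁ ≤ P.L ^ k →
        ∀ (f : Balaban1983to89.Site P 0 → ℂ) (F D : ℝ),
          (∀ z, ‖f z‖ ≤ F) → (∀ z, f z ≠ 0 → D ≤ (supDist x₀ z : ℝ)) →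
          (∀ (z : Balaban1983to89.Site P 0) (μ' : Fin P.d), (∀ ν, ν ≠ i → z ν = x₀ ν) → supDist x₀ z ≤ supDist x₀ x₁ →
              cfg (GaugeField.gaugeAct (centredGaugeDir U x₀ (2 * (P.L ^ k / 8)) i) U) ⟨z, μ'⟩ = 1) ∧
          ‖(toC (centredGaugeDir U x₀ (2 * (P.L ^ k / 8)) i (x₁.shift μ)) *
                (gBox (B1RG242Torus.α P a k * (P.L : ℝ) ^ (k * P.d)) P.eps⁻¹ U k univ *ᵥ f) (x₁.shift μ) -
              toC (centredGaugeDir U x₀ (2 * (P.L ^ k / 8)) i x₁) *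
                (gBox (B1RG242Torus.α P a k * (P.L : ℝ) ^ (k * P.d)) P.eps⁻¹ U k univ *ᵥ f) x₁) -
            (toC (centredGaugeDir U x₀ (2 * (P.L ^ k / 8)) i (x₀.shift μ)) *
                (gBox (B1RG242Torus.α P a k * (P.L : ℝ) ^ (k * P.d)) P.eps⁻¹ U k univ *ᵥ f) (x₀.shift μ) -
              toC (centredGaugeDir U x₀ (2 * (P.L ^ k / 8)) i x₀) *
                (gBox (B1RG242Torus.α P a k * (P.L : ℝ) ^ (k * P.d)) P.eps⁻¹ U k univ *ᵥ f) x₀)‖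
            ≤ c₀ * ((supDist x₀ x₁ : ℝ) / (P.L : ℝ) ^ k) ^ α * P.spacing k * P.eps * Real.exp (-(t₀ * D / (P.L : ℝ) ^ k)) * F := by
  classical
  obtain ⟨t₁, c_v, ht₁, hc_v, hval⟩ := BIJ85ScalarPropagatorSupDecay.decay110_smallField d L (by omega) hd3 hL ha
  obtain ⟨t₂, c_d, ht₂, hc_d, hder⟩ := BIJ85ScalarPropagatorSupDecayDeriv.decay110_smallField_deriv d L hd hd3 hL ha
  obtain ⟨C_H, hCH, hhol⟩ := BIJ85FlatPropagatorKernelHolder.flat_kernel_holder d L hd hL ha (le_refl (0 : ℝ)) hα0 hα1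
  obtain ⟨C_L, hCL, hloc⟩ := local_holder_bound d (by omega) hα0 hα1
  -- the rate and the constant
  set t : ℝ := min (min t₁ t₂) 1 with htdef
  have ht : 0 < t := lt_min (lt_min ht₁ ht₂) one_pos
  have ht1 : t ≤ 1 := min_le_right _ _
  have htt₁ : t ≤ t₁ := (min_le_left _ _).trans (min_le_left _ _)
  have htt₂ : t ≤ t₂ := (min_le_left _ _).trans (min_le_right _ _)
  set e : ℝ := Real.exp 1 with hedef
  have he1 : 1 ≤ e := by rw [hedef]; exact Real.one_le_exp (by norm_num)
  have he0 : 0 < e := Real.exp_pos 1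
  set K₁ : ℝ := C_L * C_H * (e + c_d * e + c_v * e ^ 3 + 256 * c_v * e ^ 3 + 2 * a * c_v * e ^ 3) with hK₁
  refine ⟨t, K₁ + 1, ht, by positivity, ?_⟩
  intro P hPd hPL k hk1 hkK U θ hθ hsmall x₀ x₁ i μ hx₁ hρ1 hρ64 f F D hF hsupp
  have hvalP := hval P hPd hPL k hk1 hkK U θ hθ hsmall
  have hderP := hder P hPd hPL k hk1 hkK U θ hθ hsmall
  have hholP := hhol P hPd hPL k hk1 hkK
  subst hPd
  -- basic quantities
  have hd1 : 1 ≤ P.d := by omega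
  have hk : k ≤ P.m + P.K := hkK.trans (Nat.le_add_left _ _)
  have hk0 : 0 + k ≤ P.m + P.K := by omega
  have hLpos : (0 : ℝ) < P.L := P.cast_L_pos
  have hL1 : (1 : ℝ) < P.L := B1RG242Torus.one_lt_cast_L P
  have hε : 0 < P.eps := P.eps_pos
  set n : ℝ := (P.L : ℝ) ^ k with hndef
  have hn : 0 < n := pow_pos hLpos k
  have hnnat : ((P.L ^ k : ℕ) : ℝ) = n := by push_cast; rw [hndef]
  have hsp : P.spacing k = n * P.eps := rfl
  have hsp0 : 0 < P.spacing k := P.spacing_pos k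
  have hα : 0 < B1RG242Torus.α P a k := mul_pos (B1.aSeq_pos ha hL1 hk1) (inv_pos.2 (pow_pos hsp0 2))
  have hαa : B1RG242Torus.α P a k * P.spacing k ^ 2 ≤ a := by
    show B1.aSeq a P.L k * (P.spacing k ^ 2)⁻¹ * P.spacing k ^ 2 ≤ a
    rw [inv_mul_cancel_right₀ (pow_ne_zero 2 hsp0.ne')]
    exact B1.aSeq_le ha hL1 k hk1
  set a' : ℝ := B1RG242Torus.α P a k * (P.L : ℝ) ^ (k * P.d) with ha'def
  have ha' : 0 < a' := mul_pos hα (pow_pos hLpos _)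
  have hc' : P.eps⁻¹ ≠ 0 := inv_ne_zero hε.ne'
  have hθ0 : 0 ≤ θ := (norm_nonneg _).trans (hθ x₀ μ μ)
  have hF0 : 0 ≤ F := (norm_nonneg _).trans (hF x₀)
  set φ := gBox a' P.eps⁻¹ U k univ *ᵥ f with hφ
  -- the pair distance and the radius
  set ρ : ℕ := supDist x₀ x₁ with hρdef
  have hρ0 : (0 : ℝ) < ρ := by exact_mod_cast hρ1
  have hρn : 64 * (ρ : ℝ) ≤ n := by rw [← hnnat]; exact_mod_cast hρ64
  set r : ℕ := P.L ^ k / 8 with hrdef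
  have hr8 : 8 * r ≤ P.L ^ k := Nat.mul_div_le (P.L ^ k) 8
  have hr8' : P.L ^ k < 8 * (r + 1) := by rw [hrdef]; omega
  have hrn : 8 * (r : ℝ) ≤ n := by rw [← hnnat]; exact_mod_cast hr8
  have hrn' : n ≤ 8 * r + 8 := by
    have h : ((P.L ^ k : ℕ) : ℝ) ≤ ((8 * (r + 1) : ℕ) : ℝ) := by exact_mod_cast hr8'.le
    rw [hnnat] at h; push_cast at h; linarith
  have hρ1' : (1 : ℝ) ≤ ρ := by exact_mod_cast hρ1
  have hn1 : (1 : ℝ) ≤ n := by linarith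
  have hr7 : (7 : ℝ) ≤ r := by linarith
  have hr4 : 4 ≤ r := by exact_mod_cast (show (4 : ℝ) ≤ r by linarith)
  have hr0 : (0 : ℝ) < r := by linarith
  have hr16 : n ≤ 16 * r := by linarith
  have hρr : 2 * ρ + 4 ≤ r := by
    have h1 : 2 * (ρ : ℝ) + 4 ≤ r := by linarith
    exact_mod_cast h1
  have hN : 4 * r + 6 ≤ P.sitesPerDir 0 := by
    have h1 := two_mul_pow_le_sitesPerDir (P := P) hk
    omega
  have hRb : 2 * (2 * r) + 4 < P.sitesPerDir 0 := by omega
  -- exponential bookkeeping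
  set E : ℝ := Real.exp (-(t * D / n)) with hEdef
  have hE0 : 0 < E := Real.exp_pos _
  have hexpD : ∀ {D₁ D₂ : ℝ}, D₂ ≤ D₁ → Real.exp (-(t * D₁ / n)) ≤ Real.exp (-(t * D₂ / n)) := fun h =>
    Real.exp_le_exp.2 (by rw [neg_le_neg_iff]; exact div_le_div_of_nonneg_right (mul_le_mul_of_nonneg_left h ht.le) hn.le)
  have hexp_t₁ : ∀ {D' : ℝ}, 0 ≤ D' → Real.exp (-(t₁ * D' / n)) ≤ Real.exp (-(t * D' / n)) := fun hD' =>
    Real.exp_le_exp.2 (by rw [neg_le_neg_iff]; exact div_le_div_of_nonneg_right (mul_le_mul_of_nonneg_right htt₁ hD') hn.le)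
  have hexp_t₂ : ∀ {D' : ℝ}, 0 ≤ D' → Real.exp (-(t₂ * D' / n)) ≤ Real.exp (-(t * D' / n)) := fun hD' =>
    Real.exp_le_exp.2 (by rw [neg_le_neg_iff]; exact div_le_div_of_nonneg_right (mul_le_mul_of_nonneg_right htt₂ hD') hn.le)
  have hslack1 : Real.exp (t * (2 * r) / n) ≤ e := by
    rw [hedef]; refine Real.exp_le_exp.2 ?_
    rw [div_le_one hn]
    have h1 : t * (2 * r) ≤ 1 * (2 * r) := mul_le_mul_of_nonneg_right ht1 (by positivity)
    linarith
  have hslack3 : Real.exp (t * (2 * r + n + 1) / n) ≤ e ^ 3 := by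
    rw [hedef, ← Real.exp_nat_mul]; refine Real.exp_le_exp.2 ?_
    rw [div_le_iff₀ hn]
    have h1 : t * (2 * r + n + 1) ≤ 1 * (2 * r + n + 1) := mul_le_mul_of_nonneg_right ht1 (by positivity)
    push_cast
    linarith
  -- distance bookkeeping: `dist(z, supp f) ≥ D − |x₀ − z|_∞`
  have hsuppz : ∀ z w, f w ≠ 0 → max (D - supDist x₀ z) 0 ≤ (supDist z w : ℝ) := fun z w hw => by
    refine max_le ?_ (Nat.cast_nonneg _)
    have h1 := hsupp w hw
    have h2 := supDist_triangle x₀ z w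
    have : ((supDist x₀ w : ℕ) : ℝ) ≤ ((supDist x₀ z + supDist z w : ℕ) : ℝ) := by exact_mod_cast h2
    push_cast at this; linarith
  ----------------------------------------------------------------------------------------------------------------
  -- the gauge
  set hg := centredGaugeDir U x₀ (2 * r) i with hhg
  set U' := GaugeField.gaugeAct hg U with hU'
  set ψ : Balaban1983to89.Site P 0 → ℂ := fun z => toC (hg z) * φ z with hψdef
  set f' : Balaban1983to89.Site P 0 → ℂ := fun z => toC (hg z) * f z with hf'def
  have hψeq : nOp a' P.eps⁻¹ U' k univ *ᵥ ψ = f' := gauge_transfer hk0 hc' ha' U hg f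
  have hnormψ : ∀ z, ‖ψ z‖ = ‖φ z‖ := fun z => by simp only [hψdef]; rw [norm_mul, norm_toC, one_mul]
  have hnormf' : ∀ z, ‖f' z‖ = ‖f z‖ := fun z => by simp only [hf'def]; rw [norm_mul, norm_toC, one_mul]
  have hcov : ∀ z ν, ‖cfg U' ⟨z, ν⟩ * ψ (z.shift ν) - ψ z‖ = ‖cfg U ⟨z, ν⟩ * φ (z.shift ν) - φ z‖ := fun z ν =>
    norm_covDiff_gaugeAct hg U φ z ν
  set γ : ℝ := ((P.d - 1 : ℕ) : ℝ) * θ with hγdef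
  have hγ0 : 0 ≤ γ := by positivity
  have hγn : γ * n ^ 2 ≤ 1 := gamma_nsq_le_one hθ0 hd1 hsmall
  have hplaq := dist1_plaqHol_le_of_plaqC U hθ
  have hgauge : ∀ z ν, supDist x₀ z ≤ 2 * r → ‖cfg U' ⟨z, ν⟩ - 1‖ ≤ γ * ((min (supDist x₀ z) (supDist x₁ z) : ℕ) : ℝ) := by
    intro z ν hz
    have h1 := dist1_centredGaugeDir_le_min U hθ0 hplaq x₀ hRb i hx₁ z hz ν
    rw [BIJ88Smooth43Axial.dist1_eq_norm_toC_sub_one] at h1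
    calc ‖cfg U' ⟨z, ν⟩ - 1‖ = ‖toC (GaugeField.gaugeAct hg U ⟨z, ν⟩) - 1‖ := rfl
      _ ≤ ((P.d - 1 : ℕ) : ℝ) * ((min (supDist x₀ z) (supDist x₁ z) : ℕ) : ℝ) * θ := h1
      _ = γ * ((min (supDist x₀ z) (supDist x₁ z) : ℕ) : ℝ) := by rw [hγdef]; ring
  -- the axis bonds are trivial
  have haxis : ∀ (z : Balaban1983to89.Site P 0) (μ' : Fin P.d), (∀ ν, ν ≠ i → z ν = x₀ ν) → supDist x₀ z ≤ ρ →
      cfg U' ⟨z, μ'⟩ = 1 := by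
    intro z μ' hz hzρ
    have hz2 : supDist x₀ z ≤ 2 * r := by omega
    have h1 := dist1_centredGaugeDir_le U hθ0 hplaq x₀ hRb i z hz2 μ' (n := 0) (fun ν hν => by
      rw [hz ν hν, sub_self]; exact le_of_eq ((B3TorusRadialSums.cdist_eq_zero_iff _).2 rfl))
    rw [Nat.cast_zero, mul_zero, zero_mul, BIJ88Smooth43Axial.dist1_eq_norm_toC_sub_one] at h1
    exact sub_eq_zero.1 (norm_le_zero_iff.1 h1)
  refine ⟨haxis, ?_⟩
  ----------------------------------------------------------------------------------------------------------------
  -- the local data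
  set S : ℝ := c_v * P.spacing k ^ 2 * F * E * e ^ 3 with hSdef
  have hS0 : 0 ≤ S := by positivity
  have hSψ : ∀ z, supDist x₀ z ≤ 2 * r + P.L ^ k + 1 → ‖ψ z‖ ≤ S := by
    intro z hz
    rw [hnormψ]
    refine (hvalP z f F _ hF (hsuppz z)).trans ?_
    have h2 : Real.exp (-(t₁ * max (D - supDist x₀ z) 0 / n)) ≤ E * e ^ 3 := by
      refine ((hexp_t₁ (le_max_right _ _)).trans (hexpD (le_max_left _ _))).trans ?_
      have hz' : (supDist x₀ z : ℝ) ≤ 2 * r + n + 1 := by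
        have : ((supDist x₀ z : ℕ) : ℝ) ≤ ((2 * r + P.L ^ k + 1 : ℕ) : ℝ) := by exact_mod_cast hz
        push_cast at this; rw [hndef]; exact this
      calc Real.exp (-(t * (D - supDist x₀ z) / n)) = E * Real.exp (t * supDist x₀ z / n) := by
            rw [hEdef, ← Real.exp_add]; congr 1; ring
        _ ≤ E * Real.exp (t * (2 * r + n + 1) / n) := by
            refine mul_le_mul_of_nonneg_left (Real.exp_le_exp.2 ?_) hE0.le
            exact div_le_div_of_nonneg_right (mul_le_mul_of_nonneg_left hz' ht.le) hn.le
        _ ≤ E * e ^ 3 := mul_le_mul_of_nonneg_left hslack3 hE0.le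
    calc c_v * P.spacing k ^ 2 * Real.exp (-(t₁ * max (D - ↑(supDist x₀ z)) 0 / n)) * F
        ≤ c_v * P.spacing k ^ 2 * (E * e ^ 3) * F := by gcongr
      _ = S := by rw [hSdef]; ring
  set Mloc : ℝ := P.eps * (c_d * P.spacing k * F * E * e) with hMlocdef
  have hMloc0 : 0 ≤ Mloc := by positivity
  have hMψ : ∀ z ν, supDist x₀ z ≤ 2 * r → ‖cfg U' ⟨z, ν⟩ * ψ (z.shift ν) - ψ z‖ ≤ Mloc := by
    intro z ν hz
    rw [hcov]
    have h1 := hderP z ν f F _ hF (hsuppz z)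
    have hcovD : ‖covD P.eps⁻¹ (cfg U) φ ⟨z, ν⟩‖ = P.eps⁻¹ * ‖cfg U ⟨z, ν⟩ * φ (z.shift ν) - φ z‖ := by
      show ‖((P.eps⁻¹ : ℝ) : ℂ) * (cfg U ⟨z, ν⟩ * φ (z.shift ν) - φ z)‖ = _
      rw [norm_mul, Complex.norm_real, Real.norm_of_nonneg (inv_nonneg.2 hε.le)]
    rw [hcovD] at h1
    have h2 : Real.exp (-(t₂ * max (D - supDist x₀ z) 0 / n)) ≤ E * e := by
      refine ((hexp_t₂ (le_max_right _ _)).trans (hexpD (le_max_left _ _))).trans ?_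
      have hz' : (supDist x₀ z : ℝ) ≤ 2 * r := by exact_mod_cast hz
      calc Real.exp (-(t * (D - supDist x₀ z) / n)) = E * Real.exp (t * supDist x₀ z / n) := by
            rw [hEdef, ← Real.exp_add]; congr 1; ring
        _ ≤ E * Real.exp (t * (2 * r) / n) := by
            refine mul_le_mul_of_nonneg_left (Real.exp_le_exp.2 ?_) hE0.le
            exact div_le_div_of_nonneg_right (mul_le_mul_of_nonneg_left hz' ht.le) hn.le
        _ ≤ E * e := mul_le_mul_of_nonneg_left hslack1 hE0.le
    have h3 : ‖cfg U ⟨z, ν⟩ * φ (z.shift ν) - φ z‖ ≤ P.eps * (c_d * P.spacing k * Real.exp (-(t₂ * max (D - ↑(supDist x₀ z)) 0 / n)) * F) := by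
      have := mul_le_mul_of_nonneg_left h1 hε.le
      rwa [← mul_assoc, mul_inv_cancel₀ hε.ne', one_mul] at this
    refine h3.trans ?_
    rw [hMlocdef]
    refine mul_le_mul_of_nonneg_left ?_ hε.le
    calc c_d * P.spacing k * Real.exp (-(t₂ * max (D - ↑(supDist x₀ z)) 0 / n)) * F ≤ c_d * P.spacing k * (E * e) * F := by gcongr
      _ = c_d * P.spacing k * F * E * e := by ring
  set Floc : ℝ := F * E * e with hFlocdef
  have hFloc0 : 0 ≤ Floc := by positivity
  have hFf' : ∀ z, supDist x₀ z ≤ 2 * r → ‖f' z‖ ≤ Floc := by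
    intro z hz
    rw [hnormf']
    by_cases hfz : f z = 0
    · rw [hfz, norm_zero]; exact hFloc0
    · have h1 : D ≤ 2 * r := by
        have := hsupp z hfz
        have h2 : ((supDist x₀ z : ℕ) : ℝ) ≤ ((2 * r : ℕ) : ℝ) := by exact_mod_cast hz
        push_cast at h2; linarith
      have h2 : 1 ≤ E * e := by
        have h3 : Real.exp (-(t * (2 * r) / n)) ≤ E := hexpD h1
        have h4 : Real.exp (-(t * (2 * r) / n)) * Real.exp (t * (2 * r) / n) = 1 := by
          rw [← Real.exp_add, neg_add_cancel, Real.exp_zero]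
        calc (1 : ℝ) = Real.exp (-(t * (2 * r) / n)) * Real.exp (t * (2 * r) / n) := h4.symm
          _ ≤ E * e := mul_le_mul h3 hslack1 (Real.exp_pos _).le hE0.le
      calc ‖f z‖ ≤ F := hF z
        _ = F * 1 := (mul_one F).symm
        _ ≤ F * (E * e) := mul_le_mul_of_nonneg_left h2 hF0
        _ = Floc := by rw [hFlocdef]; ring
  -- the Hölder envelopes of the difference kernel
  set A : ℝ := C_H * P.eps ^ 2 * (ρ : ℝ) ^ α with hAdef
  have hA0 : 0 ≤ A := by positivity
  have hK1 : ∀ z, |((B1RG242Torus.tower P a 0).G k (x₁.shift μ) z - (B1RG242Torus.tower P a 0).G k x₁ z) -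
      ((B1RG242Torus.tower P a 0).G k (x₀.shift μ) z - (B1RG242Torus.tower P a 0).G k x₀ z)| ≤
      A / (max ((min (supDist x₀ z) (supDist x₁ z) : ℕ) : ℝ) 1) ^ ((P.d : ℝ) - 1 + α) := fun z => by
    rw [hAdef]; exact hholP.1 μ x₀ x₁ z
  have hK2 : ∀ (ν : Fin P.d) z,
      |(((B1RG242Torus.tower P a 0).G k (x₁.shift μ) (z.shift ν) - (B1RG242Torus.tower P a 0).G k x₁ (z.shift ν)) -
          ((B1RG242Torus.tower P a 0).G k (x₀.shift μ) (z.shift ν) - (B1RG242Torus.tower P a 0).G k x₀ (z.shift ν))) -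
        (((B1RG242Torus.tower P a 0).G k (x₁.shift μ) z - (B1RG242Torus.tower P a 0).G k x₁ z) -
          ((B1RG242Torus.tower P a 0).G k (x₀.shift μ) z - (B1RG242Torus.tower P a 0).G k x₀ z))| ≤
      A / (max ((min (supDist x₀ z) (supDist x₁ z) : ℕ) : ℝ) 1) ^ ((P.d : ℝ) + α) := fun ν z => by
    have h := hholP.2 μ ν x₀ x₁ z
    rw [hAdef]
    refine le_trans (le_of_eq ?_) h
    congr 1; ring
  -- THE LOCAL ESTIMATE
  have hmain := hloc P rfl ha hk1 hkK hr4 hN x₀ x₁ μ hρr U' ψ f' hψeq hA0 hγ0 hS0 hMloc0 hFloc0 hK1 hK2 hgauge hSψ hMψ hFf'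
  -- its left-hand side is the target quantity
  have hLHS : (toC (hg (x₁.shift μ)) * φ (x₁.shift μ) - toC (hg x₁) * φ x₁) - (toC (hg (x₀.shift μ)) * φ (x₀.shift μ) - toC (hg x₀) * φ x₀) =
      (ψ (x₁.shift μ) - ψ x₁) - (ψ (x₀.shift μ) - ψ x₀) := rfl
  rw [hLHS]
  refine hmain.trans ?_
  ----------------------------------------------------------------------------------------------------------------
  -- the powers
  set Pw : ℝ := (r : ℝ) ^ (1 - α) with hPw
  set Qw : ℝ := ((r : ℝ) + (P.L : ℝ) ^ k) ^ (1 - α) with hQw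
  set W : ℝ := (ρ : ℝ) ^ α * n ^ (1 - α) with hWdef
  have h1α : 0 ≤ 1 - α := by linarith
  have hρα : 0 ≤ (ρ : ℝ) ^ α := Real.rpow_nonneg hρ0.le α
  have hnα : 0 < n ^ (1 - α) := Real.rpow_pos_of_pos hn _
  have hW0 : 0 ≤ W := by positivity
  have hWeq : ((ρ : ℝ) / n) ^ α * n = W := div_rpow_mul_eq hρ0.le hn
  have p1 : Pw ≤ n ^ (1 - α) := Real.rpow_le_rpow hr0.le (by linarith) h1α
  have p2 : Qw ≤ 2 * n ^ (1 - α) := by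
    rw [hQw, ← hndef]
    exact rpow_le_mul_rpow (by norm_num) (by positivity) hn.le (by linarith) h1α (by linarith)
  have p3 : (r : ℝ) ^ (-α) ≤ 16 * n ^ (-α) := rpow_neg_le_of_le_mul hr0 hn hr16 hα0 hα1.le
  have p4 : n ^ (-α) * n = n ^ (1 - α) := by
    rw [show (1 : ℝ) - α = -α + 1 by ring, Real.rpow_add hn, Real.rpow_one]
  have hsp2 : P.spacing k ^ 2 = n ^ 2 * P.eps ^ 2 := by rw [hsp]; ring
  -- the five terms against `W ε² E F`
  have q1 : Floc * A * Pw ≤ (C_H * e) * (W * P.eps ^ 2 * E * F) := by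
    calc Floc * A * Pw = (C_H * e) * ((ρ : ℝ) ^ α * Pw) * P.eps ^ 2 * E * F := by rw [hFlocdef, hAdef]; ring
      _ ≤ (C_H * e) * ((ρ : ℝ) ^ α * n ^ (1 - α)) * P.eps ^ 2 * E * F := by gcongr
      _ = (C_H * e) * (W * P.eps ^ 2 * E * F) := by rw [hWdef]; ring
  have q2 : P.eps⁻¹ ^ 2 * (γ * A * (r * Pw * Mloc)) ≤ (C_H * (c_d * e)) * (W * P.eps ^ 2 * E * F) := by
    have e1 : P.eps⁻¹ ^ 2 * (γ * A * (r * Pw * Mloc)) = (C_H * (c_d * e)) * ((γ * (r * n)) * ((ρ : ℝ) ^ α * Pw)) * P.eps ^ 2 * E * F := by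
      rw [hAdef, hMlocdef, hsp]; field_simp
    rw [e1]
    have h1 : γ * (r * n) ≤ 1 := by
      calc γ * (r * n) ≤ γ * (n * n) := by gcongr; linarith
        _ = γ * n ^ 2 := by ring
        _ ≤ 1 := hγn
    have h2 : (γ * (r * n)) * ((ρ : ℝ) ^ α * Pw) ≤ 1 * ((ρ : ℝ) ^ α * n ^ (1 - α)) :=
      mul_le_mul h1 (mul_le_mul_of_nonneg_left p1 hρα) (by positivity) zero_le_one
    calc (C_H * (c_d * e)) * ((γ * (r * n)) * ((ρ : ℝ) ^ α * Pw)) * P.eps ^ 2 * E * F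
        ≤ (C_H * (c_d * e)) * (1 * ((ρ : ℝ) ^ α * n ^ (1 - α))) * P.eps ^ 2 * E * F := by gcongr
      _ = (C_H * (c_d * e)) * (W * P.eps ^ 2 * E * F) := by rw [hWdef]; ring
  have q3 : P.eps⁻¹ ^ 2 * (γ * A * (Pw * S)) ≤ (C_H * (c_v * e ^ 3)) * (W * P.eps ^ 2 * E * F) := by
    have e1 : P.eps⁻¹ ^ 2 * (γ * A * (Pw * S)) = (C_H * (c_v * e ^ 3)) * ((γ * n ^ 2) * ((ρ : ℝ) ^ α * Pw)) * P.eps ^ 2 * E * F := by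
      rw [hAdef, hSdef, hsp2]; field_simp
    rw [e1]
    have h2 : (γ * n ^ 2) * ((ρ : ℝ) ^ α * Pw) ≤ 1 * ((ρ : ℝ) ^ α * n ^ (1 - α)) :=
      mul_le_mul hγn (mul_le_mul_of_nonneg_left p1 hρα) (by positivity) zero_le_one
    calc (C_H * (c_v * e ^ 3)) * ((γ * n ^ 2) * ((ρ : ℝ) ^ α * Pw)) * P.eps ^ 2 * E * F
        ≤ (C_H * (c_v * e ^ 3)) * (1 * ((ρ : ℝ) ^ α * n ^ (1 - α))) * P.eps ^ 2 * E * F := by gcongr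
      _ = (C_H * (c_v * e ^ 3)) * (W * P.eps ^ 2 * E * F) := by rw [hWdef]; ring
  have q4 : P.eps⁻¹ ^ 2 * (A * S * ((r : ℝ) ^ (-α) / r)) ≤ (C_H * (256 * c_v * e ^ 3)) * (W * P.eps ^ 2 * E * F) := by
    have e1 : P.eps⁻¹ ^ 2 * (A * S * ((r : ℝ) ^ (-α) / r)) =
        (C_H * (c_v * e ^ 3)) * ((ρ : ℝ) ^ α * ((r : ℝ) ^ (-α) * (n ^ 2 / r))) * P.eps ^ 2 * E * F := by
      rw [hAdef, hSdef, hsp2]; field_simp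
    rw [e1]
    have h1 : n ^ 2 / r ≤ 16 * n := by
      rw [div_le_iff₀ hr0]
      calc n ^ 2 = n * n := sq n
        _ ≤ n * (16 * r) := mul_le_mul_of_nonneg_left hr16 hn.le
        _ = 16 * n * r := by ring
    have h2 : (r : ℝ) ^ (-α) * (n ^ 2 / r) ≤ (16 * n ^ (-α)) * (16 * n) :=
      mul_le_mul p3 h1 (by positivity) (by positivity)
    have h3 : (ρ : ℝ) ^ α * ((r : ℝ) ^ (-α) * (n ^ 2 / r)) ≤ 256 * ((ρ : ℝ) ^ α * n ^ (1 - α)) := by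
      calc (ρ : ℝ) ^ α * ((r : ℝ) ^ (-α) * (n ^ 2 / r)) ≤ (ρ : ℝ) ^ α * ((16 * n ^ (-α)) * (16 * n)) :=
            mul_le_mul_of_nonneg_left h2 hρα
        _ = 256 * ((ρ : ℝ) ^ α * (n ^ (-α) * n)) := by ring
        _ = 256 * ((ρ : ℝ) ^ α * n ^ (1 - α)) := by rw [p4]
    calc (C_H * (c_v * e ^ 3)) * ((ρ : ℝ) ^ α * ((r : ℝ) ^ (-α) * (n ^ 2 / r))) * P.eps ^ 2 * E * F
        ≤ (C_H * (c_v * e ^ 3)) * (256 * ((ρ : ℝ) ^ α * n ^ (1 - α))) * P.eps ^ 2 * E * F := by gcongr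
      _ = (C_H * (256 * c_v * e ^ 3)) * (W * P.eps ^ 2 * E * F) := by rw [hWdef]; ring
  have q5 : B1RG242Torus.α P a k * A * Qw * S ≤ (C_H * (2 * a * c_v * e ^ 3)) * (W * P.eps ^ 2 * E * F) := by
    have e1 : B1RG242Torus.α P a k * A * Qw * S =
        (C_H * (c_v * e ^ 3)) * ((B1RG242Torus.α P a k * P.spacing k ^ 2) * ((ρ : ℝ) ^ α * Qw)) * P.eps ^ 2 * E * F := by
      rw [hAdef, hSdef]; ring
    rw [e1]
    have h2 : (B1RG242Torus.α P a k * P.spacing k ^ 2) * ((ρ : ℝ) ^ α * Qw) ≤ a * (2 * ((ρ : ℝ) ^ α * n ^ (1 - α))) := by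
      refine mul_le_mul hαa ?_ (by positivity) ha.le
      calc (ρ : ℝ) ^ α * Qw ≤ (ρ : ℝ) ^ α * (2 * n ^ (1 - α)) := mul_le_mul_of_nonneg_left p2 hρα
        _ = _ := by ring
    calc (C_H * (c_v * e ^ 3)) * ((B1RG242Torus.α P a k * P.spacing k ^ 2) * ((ρ : ℝ) ^ α * Qw)) * P.eps ^ 2 * E * F
        ≤ (C_H * (c_v * e ^ 3)) * (a * (2 * ((ρ : ℝ) ^ α * n ^ (1 - α)))) * P.eps ^ 2 * E * F := by gcongr
      _ = (C_H * (2 * a * c_v * e ^ 3)) * (W * P.eps ^ 2 * E * F) := by rw [hWdef]; ring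
  have hsum : Floc * A * Pw + P.eps⁻¹ ^ 2 * (γ * A * (r * Pw * Mloc + Pw * S) + A * S * ((r : ℝ) ^ (-α) / r)) +
      B1RG242Torus.α P a k * A * Qw * S ≤
      (C_H * (e + c_d * e + c_v * e ^ 3 + 256 * c_v * e ^ 3 + 2 * a * c_v * e ^ 3)) * (W * P.eps ^ 2 * E * F) := by
    have e1 : P.eps⁻¹ ^ 2 * (γ * A * (r * Pw * Mloc + Pw * S) + A * S * ((r : ℝ) ^ (-α) / r)) =
        P.eps⁻¹ ^ 2 * (γ * A * (r * Pw * Mloc)) + P.eps⁻¹ ^ 2 * (γ * A * (Pw * S)) + P.eps⁻¹ ^ 2 * (A * S * ((r : ℝ) ^ (-α) / r)) := by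
      ring
    rw [e1]
    linarith only [q1, q2, q3, q4, q5]
  have hWε : W * P.eps ^ 2 * E * F = ((ρ : ℝ) / n) ^ α * P.spacing k * P.eps * E * F := by
    rw [← hWeq, hsp]; ring
  have hfin : C_L * ((C_H * (e + c_d * e + c_v * e ^ 3 + 256 * c_v * e ^ 3 + 2 * a * c_v * e ^ 3)) * (W * P.eps ^ 2 * E * F)) =
      K₁ * (((ρ : ℝ) / n) ^ α * P.spacing k * P.eps * E * F) := by rw [hWε, hK₁]; ring
  have hunit : 0 ≤ ((ρ : ℝ) / n) ^ α * P.spacing k * P.eps * E * F := by positivity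
  calc C_L * (Floc * A * Pw + P.eps⁻¹ ^ 2 * (γ * A * (r * Pw * Mloc + Pw * S) + A * S * ((r : ℝ) ^ (-α) / r)) +
        B1RG242Torus.α P a k * A * Qw * S)
      ≤ C_L * ((C_H * (e + c_d * e + c_v * e ^ 3 + 256 * c_v * e ^ 3 + 2 * a * c_v * e ^ 3)) * (W * P.eps ^ 2 * E * F)) :=
        mul_le_mul_of_nonneg_left hsum hCL.le
    _ = K₁ * (((ρ : ℝ) / n) ^ α * P.spacing k * P.eps * E * F) := hfin
    _ ≤ (K₁ + 1) * (((ρ : ℝ) / n) ^ α * P.spacing k * P.eps * E * F) := by nlinarith only [hunit]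
    _ = (K₁ + 1) * ((supDist x₀ x₁ : ℝ) / (P.L : ℝ) ^ k) ^ α * P.spacing k * P.eps * Real.exp (-(t * D / (P.L : ℝ) ^ k)) * F := by
        rw [hρdef, hEdef, hndef]; ring

end Leg

end

end Literature.MathematicalPhysics.QuantumFieldTheory.BalabanImbrieJaffe1984to88.BIJ85ScalarPropagatorSupDecayHolder
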